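import Literature.NumberTheory.Sieve.IwaniecBilinearSieveAssembly
import HarnessLib

/-!
# Iwaniec's bilinear linear sieve, VIII: the main regime — quantitative main-term bounds

Topic `Literature/NumberTheory/Sieve`; eighth support file for the proof of
`Literature.NumberTheory.Sieve.Iwaniec1978.lemma2_bilinearSieve` (H. Iwaniec, *A new form of the error
term in the linear sieve*, Acta Arith. 37 (1980), 307–320, Theorem 1 [IwaniecActaArith1980b]).  In the main
regime (`log u = ε² log D ≥ 200K`, `√(log D) ≥ 200K`, `ε √(log D) ≥ 30`, and `log D > ε⁻⁴` or
`ε ≤ 1/30`) the structural inequalities of `IwaniecBilinearSieveAssembly.lean` and the level bounds of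
`IwaniecBilinearSieveLevels.lean` / `IwaniecBilinearSieveStrips.lean` combine to
`∑_{d ∣ P(z)} Λ⁺_z(d) g(d) ≤ V(z) (F(log D/log z) + C (ε + ε⁻⁸ e^K / log D))` (`2 ≤ z ≤ D`) and the lower twin
(`z² ≤ D`), with `C = 5·10²⁴ (1 + C_d)²`, `C_d` the decay constant of the linear-sieve functions
(`Core.main_regime_bounds`: the three levels `Core.levelA_bounds` (fundamental lemma, tiny primes),
`Core.levelB_bounds` (Jurkat–Richert at level `D^{2ε/3}`, middle primes), `Core.levelC_bounds` (box weights and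
strips, large primes), the pure-real error arithmetic `err_pieces_real`, and the algebra `algebra_upper` /
`algebra_lower`).  Outside the main regime the trivial bound `|∑ Λ_z g| ≤ V(z)⁻¹ ≤ 3.53 K log D` suffices
(`Core.crude_regime_bounds`, `Core.crude_key`).  All the `K`-dependence is explicit (cf. the module docstring of
`IwaniecBilinearSieveLevels.lean`).  Everything is PROVED; no facts.

## References

* H. Iwaniec, *A new form of the error term in the linear sieve*, Acta Arith. 37 (1980), 307–320, §5
  (27)–(28) and p. 320. [IwaniecActaArith1980b]
-/

open Finset Real Filter
open scoped ArithmeticFunction.Moebius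

noncomputable section

namespace Literature.NumberTheory.Sieve

namespace Iwaniec1980b

/-! ### Pure-real lemmas -/

/-- A product over a rectangle is at least the least corner. [folklore] -/
theorem mul_ge_corners {x x₁ x₂ y y₁ y₂ : ℝ} (hx : x₁ ≤ x ∧ x ≤ x₂) (hy : y₁ ≤ y ∧ y ≤ y₂) :
    min (min (x₁ * y₁) (x₁ * y₂)) (min (x₂ * y₁) (x₂ * y₂)) ≤ x * y := by
  -- `x y ≥ min(x₁ y, x₂ y)` and `xᵢ y ≥ min(xᵢ y₁, xᵢ y₂)`
  have h1 : min (x₁ * y) (x₂ * y) ≤ x * y := by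
    rcases le_total 0 y with hy0 | hy0
    · exact (min_le_left _ _).trans (mul_le_mul_of_nonneg_right hx.1 hy0)
    · exact (min_le_right _ _).trans (mul_le_mul_of_nonpos_right hx.2 hy0)
  have h2 : ∀ c : ℝ, min (c * y₁) (c * y₂) ≤ c * y := by
    intro c
    rcases le_total 0 c with hc | hc
    · exact (min_le_left _ _).trans (mul_le_mul_of_nonneg_left hy.1 hc)
    · exact (min_le_right _ _).trans (mul_le_mul_of_nonpos_left hy.2 hc)
  refine le_trans ?_ h1
  exact le_min ((min_le_left _ _).trans (h2 x₁)) ((min_le_right _ _).trans (h2 x₂))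

/-- `e^{−x} ≤ n!/xⁿ` for `x > 0` (from `xⁿ/n! ≤ eˣ`). [folklore] -/
theorem exp_neg_le_factorial_div_pow {x : ℝ} (hx : 0 < x) (n : ℕ) :
    Real.exp (-x) ≤ (n.factorial : ℝ) / x ^ n := by
  have h := Real.pow_div_factorial_le_exp x hx.le n
  have hxn : 0 < x ^ n := pow_pos hx n
  have hf : (0 : ℝ) < n.factorial := by exact_mod_cast Nat.factorial_pos n
  rw [div_le_iff₀ hf] at h
  rw [Real.exp_neg, inv_le_comm₀ (Real.exp_pos x) (div_pos hf hxn), inv_div, div_le_iff₀ hf]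
  linarith

/-- `Kⁿ ≤ n! e^K` for `K ≥ 0`. [folklore] -/
theorem pow_le_factorial_mul_exp {K : ℝ} (hK : 0 ≤ K) (n : ℕ) : K ^ n ≤ (n.factorial : ℝ) * Real.exp K := by
  have h := Real.pow_div_factorial_le_exp K hK n
  have hf : (0 : ℝ) < n.factorial := by exact_mod_cast Nat.factorial_pos n
  rwa [div_le_iff₀ hf, mul_comm] at h

/-- **Upper algebra**: from `Φ⁺ ≤ V_S(1+δ)`, `Φ⁺ − Φ⁻ ≤ 2δ V_S`, `M_C ≤ V_C(F + c) + σ`, `M_C ≥ 0`, `W_C ≤ V_C⁻¹`,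
`Φ⁺ M_C + (Φ⁺ − Φ⁻) W_C ≤ V_S V_C (F + δF + (1+δ)c + (1+δ) σ V_C⁻¹ + 2δ V_C⁻²)`. [folklore] -/
theorem algebra_upper {VS VC F c σ δ Φ1 Φ0 M1 W : ℝ} (hVS : 0 < VS) (hVC : 0 < VC) (hδ : 0 ≤ δ)
    (hΦ1 : Φ1 ≤ VS * (1 + δ)) (hΦdiff : Φ1 - Φ0 ≤ 2 * δ * VS)
    (hM1 : M1 ≤ VC * (F + c) + σ) (hM10 : 0 ≤ M1) (hW : W ≤ VC⁻¹) (hW0 : 0 ≤ W) :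
    Φ1 * M1 + (Φ1 - Φ0) * W ≤
      VS * VC * (F + (δ * F + (1 + δ) * c + (1 + δ) * σ * VC⁻¹ + 2 * δ * VC⁻¹ ^ 2)) := by
  have h1 : Φ1 * M1 ≤ VS * (1 + δ) * M1 := mul_le_mul_of_nonneg_right hΦ1 hM10
  have h2 : VS * (1 + δ) * M1 ≤ VS * (1 + δ) * (VC * (F + c) + σ) :=
    mul_le_mul_of_nonneg_left hM1 (by positivity)
  have h3 : (Φ1 - Φ0) * W ≤ 2 * δ * VS * VC⁻¹ := mul_le_mul hΦdiff hW hW0 (by positivity)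
  have hid : VS * (1 + δ) * (VC * (F + c) + σ) + 2 * δ * VS * VC⁻¹ =
      VS * VC * (F + (δ * F + (1 + δ) * c + (1 + δ) * σ * VC⁻¹ + 2 * δ * VC⁻¹ ^ 2)) := by
    field_simp
    ring
  linarith

/-- **Lower algebra**: from `V_S(1−δ) ≤ Φ⁻ ≤ V_S`, `m₀ := V_C(f − c) − σ ≤ M_C⁻ ≤ V_C`, `f ≤ 1`,
`Φ⁺ − Φ⁻ ≤ 2δV_S`, `W_C ≤ V_C⁻¹`:
`Φ⁻ M_C⁻ − (Φ⁺ − Φ⁻) W_C ≥ V_S V_C (f − (c + σV_C⁻¹ + δ(1 + |f| + c + σV_C⁻¹) + 2δV_C⁻²))`. [folklore] -/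
theorem algebra_lower {VS VC f c σ δ Φ1 Φ0 M0 W : ℝ} (hVS : 0 < VS) (hVC : 0 < VC) (hf1 : f ≤ 1)
    (hc : 0 ≤ c) (hσ : 0 ≤ σ) (hδ : 0 ≤ δ)
    (hΦ0 : VS * (1 - δ) ≤ Φ0) (hΦ0' : Φ0 ≤ VS) (hΦdiff : Φ1 - Φ0 ≤ 2 * δ * VS)
    (hM0 : VC * (f - c) - σ ≤ M0) (hM0' : M0 ≤ VC) (hW : W ≤ VC⁻¹) (hW0 : 0 ≤ W) :
    VS * VC * (f - (c + σ * VC⁻¹ + δ * (1 + |f| + c + σ * VC⁻¹) + 2 * δ * VC⁻¹ ^ 2)) ≤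
      Φ0 * M0 - (Φ1 - Φ0) * W := by
  have hcor := mul_ge_corners ⟨hΦ0, hΦ0'⟩ ⟨hM0, hM0'⟩
  have h3 : (Φ1 - Φ0) * W ≤ 2 * δ * VS * VC⁻¹ := mul_le_mul hΦdiff hW hW0 (by positivity)
  -- every corner is ≥ `VS VC (f − c − σ/VC − δ(1 + |f| + c + σ/VC))`
  set L := f - c - σ * VC⁻¹ - δ * (1 + |f| + c + σ * VC⁻¹) with hL
  have habs : -|f| ≤ f ∧ f ≤ |f| := ⟨neg_abs_le f, le_abs_self f⟩
  have hσ' : 0 ≤ σ * VC⁻¹ := by positivity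
  have hm0 : VC * (f - c) - σ = VC * (f - c - σ * VC⁻¹) := by field_simp
  have c1 : VS * VC * L ≤ VS * (1 - δ) * (VC * (f - c) - σ) := by
    rw [hm0]
    have : VS * VC * L - VS * (1 - δ) * (VC * (f - c - σ * VC⁻¹)) =
        VS * VC * (L - (1 - δ) * (f - c - σ * VC⁻¹)) := by ring
    have key : L - (1 - δ) * (f - c - σ * VC⁻¹) ≤ 0 := by
      rw [hL]
      have : f - c - σ * VC⁻¹ - δ * (1 + |f| + c + σ * VC⁻¹) - (1 - δ) * (f - c - σ * VC⁻¹) =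
          -δ * (1 + |f| + c + σ * VC⁻¹ - (f - c - σ * VC⁻¹)) := by ring
      rw [this]
      have : 0 ≤ 1 + |f| + c + σ * VC⁻¹ - (f - c - σ * VC⁻¹) := by linarith [habs.2]
      nlinarith
    nlinarith [mul_pos hVS hVC]
  have c2 : VS * VC * L ≤ VS * (1 - δ) * VC := by
    have key : L ≤ 1 - δ := by
      rw [hL]; nlinarith [habs.1, abs_nonneg f]
    nlinarith [mul_pos hVS hVC]
  have c3 : VS * VC * L ≤ VS * (VC * (f - c) - σ) := by
    rw [hm0]
    have key : L ≤ f - c - σ * VC⁻¹ := by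
      rw [hL]; nlinarith [abs_nonneg f]
    nlinarith [mul_pos hVS hVC]
  have c4 : VS * VC * L ≤ VS * VC := by
    have key : L ≤ 1 := by rw [hL]; nlinarith [abs_nonneg f]
    nlinarith [mul_pos hVS hVC]
  have hmin : VS * VC * L ≤ Φ0 * M0 :=
    le_trans (le_min (le_min c1 c2) (le_min c3 c4)) hcor
  have hid : VS * VC * (f - (c + σ * VC⁻¹ + δ * (1 + |f| + c + σ * VC⁻¹) + 2 * δ * VC⁻¹ ^ 2)) =
      VS * VC * L - 2 * δ * VS * VC⁻¹ := by
    rw [hL]; field_simp; ring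
  linarith

/-- `log (min a b) = min (log a) (log b)` for positive `a, b`. [folklore] -/
theorem log_min_eq {a b : ℝ} (ha : 0 < a) (hb : 0 < b) : Real.log (min a b) = min (Real.log a) (Real.log b) := by
  rcases le_total a b with hab | hba
  · rw [min_eq_left hab, min_eq_left (Real.log_le_log ha hab)]
  · rw [min_eq_right hba, min_eq_right (Real.log_le_log hb hba)]

namespace Core

/-! ### The parameters in the main regime -/

section Params

variable {D ε : ℝ} (hD : 1 < D) (hε : 0 < ε)
include hD hε

omit hε in
/-- `log u = ε² log D`. [folklore] -/
theorem log_uu : Real.log (uu D ε) = ε ^ 2 * Real.log D := by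
  rw [uu_def, Real.log_rpow (by linarith)]

/-- `log w₁ = min(√(log D), ε² log D)`. [folklore] -/
theorem log_w1 : Real.log (w1 D ε) = min (Real.sqrt (Real.log D)) (ε ^ 2 * Real.log D) := by
  rw [w1, log_min_eq (Real.exp_pos _) (by linarith [one_lt_uu hD hε]), Real.log_exp, log_uu (ε := ε) hD]

omit hε in
/-- `log D^{ε/3} = (ε/3) log D`. [folklore] -/
theorem log_levA : Real.log (levA D ε) = ε / 3 * Real.log D := by
  rw [levA, Real.log_rpow (by linarith)]

omit hε in
/-- `log D^{2ε/3} = (2ε/3) log D`. [folklore] -/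
theorem log_levB : Real.log (levB D ε) = 2 * ε / 3 * Real.log D := by
  rw [levB, Real.log_rpow (by linarith)]

/-- `u ≤ D^{2ε/3}` and `u² ≤ D^{2ε/3}` and `u ≤ D^{ε/3}` for `ε ≤ 1/3`. [folklore] -/
theorem uu_le_levels (hε3 : ε ≤ 1 / 3) : uu D ε ≤ levA D ε ∧ uu D ε ≤ levB D ε ∧ uu D ε ^ 2 ≤ levB D ε := by
  have hD0 : (0:ℝ) < D := by linarith
  rw [uu_def, levA, levB]
  refine ⟨Real.rpow_le_rpow_of_exponent_le hD.le (by nlinarith),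
    Real.rpow_le_rpow_of_exponent_le hD.le (by nlinarith), ?_⟩
  rw [← Real.rpow_natCast, ← Real.rpow_mul hD0.le]
  exact Real.rpow_le_rpow_of_exponent_le hD.le (by push_cast; nlinarith)

/-- `D^{ε/3}, D^{2ε/3} ≤ D` (`ε ≤ 1/3`) and both `> 1`. [folklore] -/
theorem levels_basic (hε3 : ε ≤ 1 / 3) : 1 < levA D ε ∧ 1 < levB D ε ∧ levA D ε ≤ D ∧ levB D ε ≤ D := by
  have hD0 : (0:ℝ) < D := by linarith
  refine ⟨Real.one_lt_rpow hD (by positivity), Real.one_lt_rpow hD (by positivity), ?_, ?_⟩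
  · conv_rhs => rw [← Real.rpow_one D]
    exact Real.rpow_le_rpow_of_exponent_le hD.le (by linarith)
  · conv_rhs => rw [← Real.rpow_one D]
    exact Real.rpow_le_rpow_of_exponent_le hD.le (by linarith)

variable {K : ℝ}

/-- In the main regime `log u ≥ 200K ≥ …`: `2 ≤ u` and `K/log u ≤ 1/200` (assuming `log u ≥ 200 K` and `log u ≥ 1`).
[folklore] -/
theorem uu_props (hKu : 200 * K ≤ ε ^ 2 * Real.log D) (h1 : 1 ≤ ε ^ 2 * Real.log D) :
    2 ≤ uu D ε ∧ K / Real.log (uu D ε) ≤ 1 / 200 := by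
  have hlog := log_uu (ε := ε) hD
  have hu0 : 0 < uu D ε := by linarith [one_lt_uu hD hε]
  constructor
  · have : Real.log 2 ≤ Real.log (uu D ε) := by
      rw [hlog]; have := Real.log_two_lt_d9; linarith
    exact (Real.log_le_log_iff two_pos hu0).mp this
  · rw [hlog, div_le_iff₀ (by linarith)]; linarith

/-- In the main regime: `2 ≤ w₁` and `K/log w₁ ≤ 1/200`. [folklore] -/
theorem w1_props (hKu : 200 * K ≤ ε ^ 2 * Real.log D) (h1 : 1 ≤ ε ^ 2 * Real.log D)
    (hKw : 200 * K ≤ Real.sqrt (Real.log D)) (h1' : 1 ≤ Real.sqrt (Real.log D)) :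
    2 ≤ w1 D ε ∧ K / Real.log (w1 D ε) ≤ 1 / 200 ∧ 1 ≤ Real.log (w1 D ε) := by
  have hlog := log_w1 hD hε
  have hw0 : 0 < w1 D ε := by linarith [one_lt_w1 hD hε]
  have hmin1 : 1 ≤ Real.log (w1 D ε) := by rw [hlog]; exact le_min h1' h1
  have hminK : 200 * K ≤ Real.log (w1 D ε) := by rw [hlog]; exact le_min hKw hKu
  refine ⟨?_, ?_, hmin1⟩
  · have : Real.log 2 ≤ Real.log (w1 D ε) := by have := Real.log_two_lt_d9; linarith
    exact (Real.log_le_log_iff two_pos hw0).mp this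
  · rw [div_le_iff₀ (by linarith)]; linarith

/-- In the main regime: `10 log w₁ ≤ log D^{ε/3}` (the fundamental lemma applies with `s ≥ 10`). [folklore] -/
theorem ten_log_w1_le (h30 : 30 ≤ ε * Real.sqrt (Real.log D)) (hsplit : ε⁻¹ ^ 4 < Real.log D ∨ ε ≤ 1 / 30) :
    10 * Real.log (w1 D ε) ≤ Real.log (levA D ε) := by
  have hlogD : 0 < Real.log D := Real.log_pos hD
  set t := Real.log D with ht
  have hsq : Real.sqrt t * Real.sqrt t = t := Real.mul_self_sqrt hlogD.le
  have hsq0 : 0 ≤ Real.sqrt t := Real.sqrt_nonneg t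
  rw [log_w1 hD hε, log_levA (ε := ε) hD]
  rcases le_total (Real.sqrt t) (ε ^ 2 * t) with h | h
  · rw [min_eq_left h]
    -- `10 √t ≤ ε t /3 ⟸ 30 √t ≤ ε √t √t`
    nlinarith
  · rw [min_eq_right h]
    rcases hsplit with hbig | hsmall
    · -- `t > ε⁻⁴` forces `ε² t > √t`, contradicting `h` unless equality; derive `ε ≤ 1/30` impossible branch
      exfalso
      have hεt : ε⁻¹ ^ 2 < Real.sqrt t := by
        have h2 : (ε⁻¹ ^ 2) ^ 2 < t := by rw [← pow_mul]; exact hbig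
        have := Real.sqrt_lt_sqrt (by positivity) h2
        rwa [Real.sqrt_sq (by positivity)] at this
      have : ε ^ 2 * t > Real.sqrt t := by
        have hε2 : 0 < ε ^ 2 := by positivity
        have key : ε ^ 2 * Real.sqrt t > 1 := by
          have := mul_lt_mul_of_pos_left hεt hε2
          rwa [show ε ^ 2 * ε⁻¹ ^ 2 = 1 by field_simp] at this
        nlinarith
      linarith
    · nlinarith

end Params

end Core

/-! ### The error arithmetic -/

set_option maxHeartbeats 800000 in
/-- **The error pieces in the main regime** (pure real arithmetic): with `err = ε + ε⁻⁸ eᴷ/log D`, the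
quantities `a` (tiny level), `b` (middle level), `c` (box level), `σ_C` (strips), `V_C⁻¹`, `V_B⁻²` bounded as
in the main regime, and `δ = a + b + ab + 2aV_B⁻²`, every monomial of the final error is `≤ C · err`.
[cite: IwaniecActaArith1980b, p. 320] -/
theorem err_pieces_real {ε t K Cd a b c σC VCi VBi2 : ℝ}
    (hε : 0 < ε) (hε1 : ε ≤ 1) (ht : 1 ≤ t) (hK : 1 ≤ K) (hCd : 0 ≤ Cd)
    (ha0 : 0 ≤ a) (ha1 : a ≤ 2.5e10 * K ^ 10 * ε⁻¹ ^ 2 / t) (ha2 : a ≤ 1.1e13 * K ^ 10 * ε⁻¹ ^ 4 / t ^ 2)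
    (ha3 : a ≤ 3.5e8 * K ^ 10)
    (hb0 : 0 ≤ b) (hb1 : b ≤ (1.5 * Cd + 9021) * ε) (hb2 : b ≤ Cd + 6014) (hb3 : b * ε⁻¹ ^ 4 ≤ 912 * (Cd + 6014) * ε)
    (hc1 : c ≤ 4.5e5 * K * ε⁻¹ ^ 2 / t)
    (hσ1 : σC ≤ 0.34 * ε + 1.02 * K * ε⁻¹ ^ 8 / t)
    (hVC0 : 0 ≤ VCi) (hVC : VCi ≤ 2 * ε⁻¹ ^ 2) (hVB0 : 0 ≤ VBi2) (hVB : VBi2 ≤ 2 + 8 * ε ^ 4 * t)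
    (hK11 : K ^ 11 ≤ 4e7 * Real.exp K) (hK10 : K ^ 10 ≤ 3.7e6 * Real.exp K) (hK1e : K ≤ Real.exp K) :
    let E := ε + ε⁻¹ ^ 8 * Real.exp K / t
    let δ := a + b + a * b + 2 * a * VBi2
    let Bm := Cd + 6014
    0 ≤ E ∧ c ≤ 4.5e5 * E ∧ σC ≤ 1.36 * E ∧ 0 ≤ δ ∧
      δ ≤ ((5 + Bm) * 9.25e16 + (1.5 * Cd + 9021) + 16 * 4.1e19) * E ∧
      δ * σC ≤ 0.34 * (((5 + Bm) * 9.25e16 + (1.5 * Cd + 9021) + 16 * 4.1e19) * E) +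
        1.02 * (((5 + Bm) * 1.4e16 + Bm + 16 * 1e18) * E) ∧
      2 * δ * VCi ^ 2 ≤ 8 * (((5 + Bm) * 9.25e16 + 912 * Bm + 16 * 4.1e19) * E) := by
  intro E δ Bm
  have hE : E = ε + ε⁻¹ ^ 8 * Real.exp K / t := rfl
  have hBm : Bm = Cd + 6014 := rfl
  have ht0 : 0 < t := by linarith
  have heK : 0 < Real.exp K := Real.exp_pos K
  have hinv1 : 1 ≤ ε⁻¹ := one_le_inv₀ hε |>.mpr hε1
  have hinv0 : 0 < ε⁻¹ := by positivity
  have hp2 : ε⁻¹ ^ 2 ≤ ε⁻¹ ^ 8 := pow_le_pow_right₀ hinv1 (by norm_num)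
  have hp4 : ε⁻¹ ^ 4 ≤ ε⁻¹ ^ 8 := pow_le_pow_right₀ hinv1 (by norm_num)
  have hp6 : ε⁻¹ ^ 6 ≤ ε⁻¹ ^ 8 := pow_le_pow_right₀ hinv1 (by norm_num)
  have he8 : 1 ≤ ε⁻¹ ^ 8 := one_le_pow₀ hinv1
  have hpos8 : 0 ≤ ε⁻¹ ^ 8 * Real.exp K / t := by positivity
  have hEε : ε ≤ E := by rw [hE]; linarith
  have hE2 : ε⁻¹ ^ 8 * Real.exp K / t ≤ E := by rw [hE]; linarith
  have hE0 : 0 ≤ E := le_trans hε.le hEε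
  have hBm0 : 0 ≤ Bm := by rw [hBm]; linarith
  -- basic conversions `K^n ε^{-k}/t ≤ C e^K ε^{-8}/t ≤ C E`
  have conv : ∀ {X C : ℝ}, 0 ≤ C → X ≤ C * Real.exp K * ε⁻¹ ^ 8 / t → X ≤ C * E := by
    intro X C hC h
    calc X ≤ C * Real.exp K * ε⁻¹ ^ 8 / t := h
      _ = C * (ε⁻¹ ^ 8 * Real.exp K / t) := by ring
      _ ≤ C * E := mul_le_mul_of_nonneg_left hE2 hC
  -- A1: `a ≤ 9.25e16 E`
  have A1 : a ≤ 9.25e16 * E := by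
    refine conv (by norm_num) (ha1.trans ?_)
    rw [div_le_div_iff_of_pos_right ht0]
    have : K ^ 10 * ε⁻¹ ^ 2 ≤ 3.7e6 * Real.exp K * ε⁻¹ ^ 8 :=
      mul_le_mul hK10 hp2 (by positivity) (by positivity)
    linarith
  -- A2: `a ε⁻⁴ ≤ 9.25e16 E`
  have A2 : a * ε⁻¹ ^ 4 ≤ 9.25e16 * E := by
    refine conv (by norm_num) ?_
    have h := mul_le_mul_of_nonneg_right ha1 (by positivity : (0:ℝ) ≤ ε⁻¹ ^ 4)
    refine h.trans ?_
    rw [div_mul_eq_mul_div, div_le_div_iff_of_pos_right ht0]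
    have : K ^ 10 * (ε⁻¹ ^ 2 * ε⁻¹ ^ 4) ≤ 3.7e6 * Real.exp K * ε⁻¹ ^ 8 := by
      rw [← pow_add]; exact mul_le_mul hK10 hp6 (by positivity) (by positivity)
    have h2 : 2.5e10 * K ^ 10 * ε⁻¹ ^ 2 * ε⁻¹ ^ 4 = 2.5e10 * (K ^ 10 * (ε⁻¹ ^ 2 * ε⁻¹ ^ 4)) := by ring
    linarith
  -- A3: `a ε⁴ t ≤ 4.1e19 E`
  have A3 : a * (ε ^ 4 * t) ≤ 4.1e19 * E := by
    refine conv (by norm_num) ?_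
    have h := mul_le_mul_of_nonneg_right ha2 (by positivity : (0:ℝ) ≤ ε ^ 4 * t)
    refine h.trans ?_
    have hεε : ε⁻¹ ^ 4 * ε ^ 4 = 1 := by rw [← mul_pow, inv_mul_cancel₀ hε.ne', one_pow]
    have hid : 1.1e13 * K ^ 10 * ε⁻¹ ^ 4 / t ^ 2 * (ε ^ 4 * t) = 1.1e13 * K ^ 10 * (ε⁻¹ ^ 4 * ε ^ 4) / t := by
      rw [div_mul_eq_mul_div, pow_two, show 1.1e13 * K ^ 10 * ε⁻¹ ^ 4 * (ε ^ 4 * t) =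
        1.1e13 * K ^ 10 * (ε⁻¹ ^ 4 * ε ^ 4) * t by ring, mul_div_mul_right _ _ ht0.ne']
    rw [hid, hεε, mul_one, div_le_div_iff_of_pos_right ht0]
    have : K ^ 10 * 1 ≤ 3.7e6 * Real.exp K * ε⁻¹ ^ 8 := by
      have := mul_le_mul hK10 he8 (by norm_num) (by positivity : (0:ℝ) ≤ 3.7e6 * Real.exp K); linarith
    have hY : 0 ≤ Real.exp K * ε⁻¹ ^ 8 := by positivity
    nlinarith [hY]
  -- A4: `a t ≤ 4.1e19 E`
  have A4 : a * t ≤ 4.1e19 * E := by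
    refine conv (by norm_num) ?_
    have h := mul_le_mul_of_nonneg_right ha2 ht0.le
    refine h.trans ?_
    have hid : 1.1e13 * K ^ 10 * ε⁻¹ ^ 4 / t ^ 2 * t = 1.1e13 * K ^ 10 * ε⁻¹ ^ 4 / t := by
      rw [div_mul_eq_mul_div, pow_two, mul_div_mul_right _ _ ht0.ne']
    rw [hid, div_le_div_iff_of_pos_right ht0]
    have : K ^ 10 * ε⁻¹ ^ 4 ≤ 3.7e6 * Real.exp K * ε⁻¹ ^ 8 := mul_le_mul hK10 hp4 (by positivity) (by positivity)
    have hY : 0 ≤ Real.exp K * ε⁻¹ ^ 8 := by positivity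
    nlinarith [hY]
  -- B bounds
  have B1 : b ≤ (1.5 * Cd + 9021) * E := hb1.trans (mul_le_mul_of_nonneg_left hEε (by linarith))
  have B3 : b * ε⁻¹ ^ 4 ≤ 912 * Bm * E := hb3.trans (by rw [hBm]; exact mul_le_mul_of_nonneg_left hEε (by positivity))
  -- δ and its three weighted forms
  have hδ : δ = a + b + a * b + 2 * a * VBi2 := rfl
  have hδ0 : 0 ≤ δ := by show 0 ≤ a + b + a * b + 2 * a * VBi2; positivity
  have Dab : a * b ≤ Bm * a := by rw [mul_comm]; exact mul_le_mul_of_nonneg_right hb2 ha0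
  have DaV : 2 * a * VBi2 ≤ 4 * a + 16 * (a * (ε ^ 4 * t)) := by
    have := mul_le_mul_of_nonneg_left hVB ha0
    have h2 : a * (2 + 8 * ε ^ 4 * t) = 2 * a + 8 * (a * (ε ^ 4 * t)) := by ring
    have h3 : 2 * a * VBi2 = 2 * (a * VBi2) := by ring
    linarith
  have D1 : δ ≤ (5 + Bm) * a + b + 16 * (a * (ε ^ 4 * t)) := by rw [hδ]; linarith
  have D1E : δ ≤ ((5 + Bm) * 9.25e16 + (1.5 * Cd + 9021) + 16 * 4.1e19) * E := by
    have := mul_le_mul_of_nonneg_left A1 (by positivity : (0:ℝ) ≤ 5 + Bm)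
    linarith [D1, A3, B1]
  -- δ ε⁻⁴
  have D2 : δ * ε⁻¹ ^ 4 ≤ ((5 + Bm) * 9.25e16 + 912 * Bm + 16 * 4.1e19) * E := by
    have h1 : δ * ε⁻¹ ^ 4 ≤ ((5 + Bm) * a + b + 16 * (a * (ε ^ 4 * t))) * ε⁻¹ ^ 4 :=
      mul_le_mul_of_nonneg_right D1 (by positivity)
    have h2 : (a * (ε ^ 4 * t)) * ε⁻¹ ^ 4 = a * t := by
      have hεε : ε ^ 4 * ε⁻¹ ^ 4 = 1 := by rw [← mul_pow, mul_inv_cancel₀ hε.ne', one_pow]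
      calc (a * (ε ^ 4 * t)) * ε⁻¹ ^ 4 = a * t * (ε ^ 4 * ε⁻¹ ^ 4) := by ring
        _ = a * t := by rw [hεε, mul_one]
    have h3 : ((5 + Bm) * a + b + 16 * (a * (ε ^ 4 * t))) * ε⁻¹ ^ 4 =
        (5 + Bm) * (a * ε⁻¹ ^ 4) + b * ε⁻¹ ^ 4 + 16 * (a * t) := by rw [← h2]; ring
    rw [h3] at h1
    have := mul_le_mul_of_nonneg_left A2 (by positivity : (0:ℝ) ≤ 5 + Bm)
    linarith [A4, B3]
  -- δ K ε⁻⁸ / t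
  have D3 : δ * (K * ε⁻¹ ^ 8 / t) ≤ ((5 + Bm) * 1.4e16 + Bm + 16 * 1e18) * E := by
    have h1 : δ * (K * ε⁻¹ ^ 8 / t) ≤ ((5 + Bm) * a + b + 16 * (a * (ε ^ 4 * t))) * (K * ε⁻¹ ^ 8 / t) :=
      mul_le_mul_of_nonneg_right D1 (by positivity)
    -- `a K ε⁻⁸/t ≤ 1.4e16 E`
    have e1 : a * (K * ε⁻¹ ^ 8 / t) ≤ 1.4e16 * E := by
      refine conv (by norm_num) ?_
      have := mul_le_mul_of_nonneg_right ha3 (by positivity : (0:ℝ) ≤ K * ε⁻¹ ^ 8 / t)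
      refine this.trans ?_
      rw [show 3.5e8 * K ^ 10 * (K * ε⁻¹ ^ 8 / t) = 3.5e8 * K ^ 11 * ε⁻¹ ^ 8 / t by ring,
        div_le_div_iff_of_pos_right ht0]
      have := mul_le_mul_of_nonneg_right hK11 (by positivity : (0:ℝ) ≤ ε⁻¹ ^ 8)
      linarith
    -- `b K ε⁻⁸/t ≤ Bm E`
    have e2 : b * (K * ε⁻¹ ^ 8 / t) ≤ Bm * E := by
      have := mul_le_mul hb2 (show K * ε⁻¹ ^ 8 / t ≤ Real.exp K * ε⁻¹ ^ 8 / t from by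
        rw [div_le_div_iff_of_pos_right ht0]; exact mul_le_mul_of_nonneg_right hK1e (by positivity))
        (by positivity) hBm0
      calc b * (K * ε⁻¹ ^ 8 / t) ≤ Bm * (Real.exp K * ε⁻¹ ^ 8 / t) := this
        _ = Bm * (ε⁻¹ ^ 8 * Real.exp K / t) := by ring
        _ ≤ Bm * E := mul_le_mul_of_nonneg_left hE2 hBm0
    -- `a ε⁴ t · K ε⁻⁸/t = a K ε⁻⁴ ≤ 1e18 E`
    have e3 : (a * (ε ^ 4 * t)) * (K * ε⁻¹ ^ 8 / t) ≤ 1e18 * E := by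
      have hid : (a * (ε ^ 4 * t)) * (K * ε⁻¹ ^ 8 / t) = a * K * ε⁻¹ ^ 4 := by
        have hεε : ε ^ 4 * ε⁻¹ ^ 8 = ε⁻¹ ^ 4 := by
          rw [show ε⁻¹ ^ 8 = ε⁻¹ ^ 4 * ε⁻¹ ^ 4 by rw [← pow_add], ← mul_assoc, ← mul_pow,
            mul_inv_cancel₀ hε.ne', one_pow, one_mul]
        have htt : t * t⁻¹ = 1 := mul_inv_cancel₀ ht0.ne'
        calc (a * (ε ^ 4 * t)) * (K * ε⁻¹ ^ 8 / t) = a * K * (ε ^ 4 * ε⁻¹ ^ 8) * (t * t⁻¹) := by ring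
          _ = a * K * ε⁻¹ ^ 4 := by rw [hεε, htt, mul_one]
      rw [hid]
      refine conv (by norm_num) ?_
      have := mul_le_mul_of_nonneg_right ha1 (by positivity : (0:ℝ) ≤ K * ε⁻¹ ^ 4)
      calc a * K * ε⁻¹ ^ 4 = a * (K * ε⁻¹ ^ 4) := by ring
        _ ≤ 2.5e10 * K ^ 10 * ε⁻¹ ^ 2 / t * (K * ε⁻¹ ^ 4) := this
        _ = 2.5e10 * K ^ 11 * (ε⁻¹ ^ 2 * ε⁻¹ ^ 4) / t := by ring
        _ ≤ 1e18 * Real.exp K * ε⁻¹ ^ 8 / t := by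
            rw [← pow_add, div_le_div_iff_of_pos_right ht0]
            have := mul_le_mul hK11 hp6 (by positivity) (by positivity : (0:ℝ) ≤ 4e7 * Real.exp K)
            linarith
    have h3 : ((5 + Bm) * a + b + 16 * (a * (ε ^ 4 * t))) * (K * ε⁻¹ ^ 8 / t) =
        (5 + Bm) * (a * (K * ε⁻¹ ^ 8 / t)) + b * (K * ε⁻¹ ^ 8 / t) + 16 * ((a * (ε ^ 4 * t)) * (K * ε⁻¹ ^ 8 / t)) := by
      ring
    rw [h3] at h1
    have := mul_le_mul_of_nonneg_left e1 (by positivity : (0:ℝ) ≤ 5 + Bm)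
    linarith [e2, e3]
  -- the four terms
  have hc1E : c ≤ 4.5e5 * E := by
    refine conv (by norm_num) (hc1.trans ?_)
    rw [div_le_div_iff_of_pos_right ht0]
    have := mul_le_mul hK1e hp2 (by positivity) heK.le
    linarith
  have hKt : K * ε⁻¹ ^ 8 / t ≤ E := by
    refine le_trans ?_ hE2
    rw [div_le_div_iff_of_pos_right ht0]
    calc K * ε⁻¹ ^ 8 ≤ Real.exp K * ε⁻¹ ^ 8 := mul_le_mul_of_nonneg_right hK1e (by positivity)
      _ = ε⁻¹ ^ 8 * Real.exp K := mul_comm _ _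
  have hσ1' : σC ≤ 0.34 * ε + 1.02 * (K * ε⁻¹ ^ 8 / t) := by
    have : 1.02 * K * ε⁻¹ ^ 8 / t = 1.02 * (K * ε⁻¹ ^ 8 / t) := by ring
    linarith [hσ1]
  have hσE : σC ≤ 1.36 * E := by linarith [hσ1', hEε, hKt]
  set Cδ := (5 + Bm) * 9.25e16 + (1.5 * Cd + 9021) + 16 * 4.1e19 with hCδ
  set C3 := (5 + Bm) * 1.4e16 + Bm + 16 * 1e18 with hC3
  have hCδ0 : 0 ≤ Cδ := by rw [hCδ]; positivity
  have T3' : δ * σC ≤ 0.34 * (Cδ * E) + 1.02 * (C3 * E) := by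
    have h1 : δ * σC ≤ δ * (0.34 * ε + 1.02 * (K * ε⁻¹ ^ 8 / t)) := mul_le_mul_of_nonneg_left hσ1' hδ0
    have h2 : δ * (0.34 * ε + 1.02 * (K * ε⁻¹ ^ 8 / t)) = 0.34 * (δ * ε) + 1.02 * (δ * (K * ε⁻¹ ^ 8 / t)) := by ring
    have h3 : δ * ε ≤ Cδ * E := by
      calc δ * ε ≤ δ * 1 := mul_le_mul_of_nonneg_left hε1 hδ0
        _ = δ := mul_one _
        _ ≤ Cδ * E := D1E
    linarith [D3]
  have T4 : 2 * δ * VCi ^ 2 ≤ 8 * (((5 + Bm) * 9.25e16 + 912 * Bm + 16 * 4.1e19) * E) := by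
    have hV2 : VCi ^ 2 ≤ 4 * ε⁻¹ ^ 4 := by
      calc VCi ^ 2 ≤ (2 * ε⁻¹ ^ 2) ^ 2 := pow_le_pow_left₀ hVC0 hVC 2
        _ = 4 * ε⁻¹ ^ 4 := by ring
    have h1 : δ * VCi ^ 2 ≤ δ * (4 * ε⁻¹ ^ 4) := mul_le_mul_of_nonneg_left hV2 hδ0
    have h2 : δ * (4 * ε⁻¹ ^ 4) = 4 * (δ * ε⁻¹ ^ 4) := by ring
    linarith [D2]
  exact ⟨hE0, hc1E, hσE, hδ0, D1E, T3', T4⟩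


/-! ### Numerical constants -/

/-- `eⁿ ≤ 2.7182818286ⁿ`. [folklore] -/
theorem exp_nat_le_pow (n : ℕ) : Real.exp n ≤ (2.7182818286 : ℝ) ^ n := by
  rw [← Real.exp_one_pow]
  exact pow_le_pow_left₀ (Real.exp_pos _).le Real.exp_one_lt_d9.le n

/-- `e^{10} ≤ 22027`. [folklore] -/
theorem exp_ten_le : Real.exp 10 ≤ 22027 := by
  have h := exp_nat_le_pow 10
  rw [show ((10 : ℕ) : ℝ) = 10 by norm_num] at h
  exact h.trans (by norm_num)

/-- `e^{13} ≤ 442414`. [folklore] -/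
theorem exp_thirteen_le : Real.exp 13 ≤ 442414 := by
  have h := exp_nat_le_pow 13
  rw [show ((13 : ℕ) : ℝ) = 13 by norm_num] at h
  exact h.trans (by norm_num)

/-- `e^{14} ≤ 1202605`. [folklore] -/
theorem exp_fourteen_le : Real.exp 14 ≤ 1202605 := by
  have h := exp_nat_le_pow 14
  rw [show ((14 : ℕ) : ℝ) = 14 by norm_num] at h
  exact h.trans (by norm_num)

/-- `2e^γ ≤ 4`. [folklore] -/
theorem two_exp_gamma_le_four : 2 * Real.exp Real.eulerMascheroniConstant ≤ 4 := by
  have hγ := Real.eulerMascheroniConstant_lt_two_thirds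
  have h2 : Real.exp Real.eulerMascheroniConstant ≤ 2 := by
    have : Real.eulerMascheroniConstant ≤ Real.log 2 := by have := Real.log_two_gt_d9; linarith
    calc Real.exp Real.eulerMascheroniConstant ≤ Real.exp (Real.log 2) := Real.exp_le_exp.mpr this
      _ = 2 := Real.exp_log two_pos
  linarith

/-- `K'^{10} = (1 + K/log 2)^{10} ≤ 7800 K^{10}` for `K ≥ 1`. [folklore] -/
theorem kprime_pow_ten_le {K : ℝ} (hK : 1 ≤ K) : (1 + K / Real.log 2) ^ 10 ≤ 7800 * K ^ 10 := by
  have hl : 0.6931471803 < Real.log 2 := Real.log_two_gt_d9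
  have h1 : K / Real.log 2 ≤ 1.443 * K := by
    rw [div_le_iff₀ (by linarith)]; nlinarith
  have h2 : 1 + K / Real.log 2 ≤ 2.443 * K := by linarith
  have h0 : 0 ≤ 1 + K / Real.log 2 := by positivity
  calc (1 + K / Real.log 2) ^ 10 ≤ (2.443 * K) ^ 10 := pow_le_pow_left₀ h0 h2 10
    _ = 2.443 ^ 10 * K ^ 10 := mul_pow _ _ _
    _ ≤ 7800 * K ^ 10 := mul_le_mul_of_nonneg_right (by norm_num) (by positivity)

/-- `K^{11} ≤ 4·10⁷ eᴷ`, `K^{10} ≤ 3.7·10⁶ eᴷ`, `K ≤ eᴷ` for `K ≥ 0`. [folklore] -/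
theorem pow_exp_bounds {K : ℝ} (hK : 0 ≤ K) :
    K ^ 11 ≤ 4e7 * Real.exp K ∧ K ^ 10 ≤ 3.7e6 * Real.exp K ∧ K ≤ Real.exp K := by
  have h11 := pow_le_factorial_mul_exp hK 11
  have h10 := pow_le_factorial_mul_exp hK 10
  have h1 := pow_le_factorial_mul_exp hK 1
  rw [show ((Nat.factorial 11 : ℕ) : ℝ) = 39916800 by norm_num [Nat.factorial]] at h11
  rw [show ((Nat.factorial 10 : ℕ) : ℝ) = 3628800 by norm_num [Nat.factorial]] at h10
  rw [show ((Nat.factorial 1 : ℕ) : ℝ) = 1 by norm_num [Nat.factorial], pow_one, one_mul] at h1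
  have he : 0 < Real.exp K := Real.exp_pos K
  exact ⟨h11.trans (by nlinarith), h10.trans (by nlinarith), h1⟩

/-! ### The sieve functions -/

/-- `1 ≤ F(s) ≤ 4 + C_d` for `s ≥ 1`, given the decay constant. [folklore] -/
theorem upperSieveFun_bounds {Cd : ℝ} (hCd : 0 ≤ Cd)
    (hCdF : ∀ s : ℝ, 1 ≤ s → |upperSieveFun 1 s - 1| ≤ Cd * Real.exp (-s)) {s : ℝ} (hs : 1 ≤ s) :
    1 ≤ upperSieveFun 1 s ∧ upperSieveFun 1 s ≤ 4 + Cd := by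
  have hone : 1 ≤ upperSieveFun 1 s := by
    have := BetaSieve.Iwaniec1980_lemma18_holds.one_le_upper (by norm_num : (1:ℝ) / 2 ≤ 1)
      JurkatRichert.isGreatestBetaSieveData_linear (s := s) (by linarith)
    simpa using this
  refine ⟨hone, ?_⟩
  rcases le_or_gt s 3 with hs3 | hs3
  · rw [upperSieveFun_one_eq_holds ⟨by linarith, hs3⟩]
    have h4 := two_exp_gamma_le_four
    have : 2 * Real.exp Real.eulerMascheroniConstant / s ≤ 2 * Real.exp Real.eulerMascheroniConstant :=
      div_le_self (by positivity) hs
    linarith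
  · have h := (abs_le.mp (hCdF s hs)).2
    have he : Real.exp (-s) ≤ 1 := Real.exp_le_one_iff.mpr (by linarith)
    have : Cd * Real.exp (-s) ≤ Cd := mul_le_of_le_one_right hCd he
    linarith

/-- `f(s) ≤ 1` and `|f(s)| ≤ 1 + C_d` for `s ≥ 2`. [folklore] -/
theorem lowerSieveFun_bounds {Cd : ℝ} (hCd : 0 ≤ Cd)
    (hCdf : ∀ s : ℝ, 2 ≤ s → |lowerSieveFun 1 s - 1| ≤ Cd * Real.exp (-s)) {s : ℝ} (hs : 2 ≤ s) :
    lowerSieveFun 1 s ≤ 1 ∧ |lowerSieveFun 1 s| ≤ 1 + Cd := by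
  have hle : lowerSieveFun 1 s ≤ 1 := by
    have := BetaSieve.Iwaniec1980_lemma18_holds.lower_le_one (by norm_num : (1:ℝ) / 2 ≤ 1)
      JurkatRichert.isGreatestBetaSieveData_linear (s := s)
        (by show siftingLimit 1 ≤ s; rw [siftingLimit_one_holds]; exact hs)
    simpa using this
  refine ⟨hle, ?_⟩
  have h := abs_le.mp (hCdf s hs)
  have he : Real.exp (-s) ≤ 1 := Real.exp_le_one_iff.mpr (by linarith)
  have : Cd * Real.exp (-s) ≤ Cd := mul_le_of_le_one_right hCd he
  rw [abs_le]
  constructor <;> linarith [h.1, h.2]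

namespace Core

section Regime

variable {D ε : ℝ} (hD : 1 < D) (hε : 0 < ε) {g : ArithmeticFunction ℝ} (hg : g.IsMultiplicative) {K : ℝ}
  (hK1 : 1 ≤ K)
  (h1 : ∀ w z : ℝ, 2 ≤ w → w < z →
    ∏ p ∈ (Nat.primesBelow ⌈z⌉₊).filter (fun p : ℕ => w ≤ (p : ℝ)), (1 - g p)⁻¹ ≤
      Real.log z / Real.log w * (1 + K / Real.log w))
  (h01 : ∀ p : ℕ, p.Prime → 0 ≤ g p ∧ g p < 1)
include hD hε hg hK1 h1 h01

omit hD hε hg hK1 h1 h01 in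
/-- `P(z'', z') = P(w₁, z')` over the middle range: both empty when `z' ≤ w₁`. [folklore] -/
theorem primesProdIco_zT_zS (z : ℝ) :
    primesProdIco (zT (D := D) (ε := ε) z) (zS (D := D) (ε := ε) z) =
      primesProdIco (w1 D ε) (zS (D := D) (ε := ε) z) := by
  rw [zT_eq_min_zS]
  rcases le_total (zS (D := D) (ε := ε) z) (w1 D ε) with h | h
  · rw [min_eq_left h, primesProdIco_eq_one_of_le le_rfl, primesProdIco_eq_one_of_le h]
  · rw [min_eq_right h]

omit hD hε hg hK1 h1 h01 in
/-- `P(z', z) = P(u, z)`: both empty when `z ≤ u`. [folklore] -/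
theorem primesProdIco_zS (z : ℝ) :
    primesProdIco (zS (D := D) (ε := ε) z) z = primesProdIco (uu D ε) z := by
  rw [zS]
  rcases le_total z (uu D ε) with h | h
  · rw [min_eq_left h, primesProdIco_eq_one_of_le le_rfl, primesProdIco_eq_one_of_le h]
  · rw [min_eq_right h]

/-- **The tiny level in the main regime**: `Φ_A⁺ ≤ V_T(1 + a)`, `Φ_A⁻ ≥ V_T(1 − a)` with
`a = 2K'^{10} e^{10 − s_A}` and the three bounds on `a` used in the error arithmetic. [folklore] -/
theorem levelA_bounds (hε3 : ε ≤ 1 / 3) (hKu : 200 * K ≤ ε ^ 2 * Real.log D)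
    (hKw : 200 * K ≤ Real.sqrt (Real.log D)) (h30 : 30 ≤ ε * Real.sqrt (Real.log D))
    (hsplit : ε⁻¹ ^ 4 < Real.log D ∨ ε ≤ 1 / 30) {z : ℝ} (hz : 2 ≤ z) :
    ∃ a : ℝ, 0 ≤ a ∧ a ≤ 2.5e10 * K ^ 10 * ε⁻¹ ^ 2 / Real.log D ∧
      a ≤ 1.1e13 * K ^ 10 * ε⁻¹ ^ 4 / Real.log D ^ 2 ∧ a ≤ 3.5e8 * K ^ 10 ∧
      PhiA (D := D) (ε := ε) g 1 z ≤ BetaSieve.vprod g (primesProdBelow (zT (D := D) (ε := ε) z)) * (1 + a) ∧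
      BetaSieve.vprod g (primesProdBelow (zT (D := D) (ε := ε) z)) * (1 - a) ≤ PhiA (D := D) (ε := ε) g 0 z := by
  have hK0 : 0 ≤ K := by linarith
  set t := Real.log D with ht
  have ht0 : 0 < t := Real.log_pos hD
  have hε2t : 200 ≤ ε ^ 2 * t := le_trans (by linarith) hKu
  have hsqrt : 200 ≤ Real.sqrt t := le_trans (by linarith) hKw
  obtain ⟨hw2, -, hlw1⟩ := w1_props hD hε hKu (by linarith) hKw (by linarith)
  have hten := ten_log_w1_le hD hε h30 hsplit
  obtain ⟨hlevA1, -, -, -⟩ := levels_basic hD hε hε3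
  set y := zT (D := D) (ε := ε) z with hy
  have hy2 : 2 ≤ y := le_min hz hw2
  have hyw : y ≤ w1 D ε := min_le_right _ _
  have hlogy : Real.log y ≤ Real.log (w1 D ε) := Real.log_le_log (by linarith) hyw
  have hlogy0 : 0 < Real.log y := Real.log_pos (by linarith)
  have hyℓ : 10 * Real.log y ≤ Real.log (levA D ε) := by linarith
  have hdim := hasSieveDimension_of_iwaniec hK0 h1 h01
  set sA := Real.log (levA D ε) / Real.log y with hsA
  set a := 2 * (1 + K / Real.log 2) ^ (10 : ℕ) * Real.exp (10 - sA) with ha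
  have hA := fun par => abs_mainSum_ten_sub_vprod_le hg hdim hy2 hlevA1 hyℓ par
  -- lower bounds for `s_A`
  have hlevApos : 0 ≤ Real.log (levA D ε) := by rw [log_levA (ε := ε) hD]; positivity
  have hsAw : Real.log (levA D ε) / Real.log (w1 D ε) ≤ sA := div_le_div_of_nonneg_left hlevApos hlogy0 hlogy
  have hlogw := log_w1 hD hε
  have hsqt : Real.sqrt t * Real.sqrt t = t := Real.mul_self_sqrt ht0.le
  have hsq0 : 0 < Real.sqrt t := by linarith
  have hsA1 : ε * Real.sqrt t / 3 ≤ sA := by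
    refine le_trans ?_ hsAw
    rw [log_levA (ε := ε) hD, le_div_iff₀ (by linarith)]
    have : Real.log (w1 D ε) ≤ Real.sqrt t := by rw [hlogw]; exact min_le_left _ _
    calc ε * Real.sqrt t / 3 * Real.log (w1 D ε) ≤ ε * Real.sqrt t / 3 * Real.sqrt t :=
          mul_le_mul_of_nonneg_left this (by positivity)
      _ = ε / 3 * t := by
          rw [show ε * Real.sqrt t / 3 * Real.sqrt t = ε / 3 * (Real.sqrt t * Real.sqrt t) by ring, hsqt]
  have hsA2 : ε⁻¹ / 3 ≤ sA := by
    refine le_trans ?_ hsAw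
    rw [log_levA (ε := ε) hD, le_div_iff₀ (by linarith)]
    have : Real.log (w1 D ε) ≤ ε ^ 2 * t := by rw [hlogw]; exact min_le_right _ _
    calc ε⁻¹ / 3 * Real.log (w1 D ε) ≤ ε⁻¹ / 3 * (ε ^ 2 * t) := mul_le_mul_of_nonneg_left this (by positivity)
      _ = ε / 3 * t := by field_simp
  have hsA0 : 0 < sA := lt_of_lt_of_le (by positivity) hsA2
  -- bounds for `e^{-s_A}`
  have hexp : Real.exp (10 - sA) = Real.exp 10 * Real.exp (-sA) := by rw [← Real.exp_add]; ring_nf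
  have he10 := exp_ten_le
  have hKp := kprime_pow_ten_le hK1
  have hE1 : Real.exp (-sA) ≤ 18 * ε⁻¹ ^ 2 / t := by
    have h := exp_neg_le_factorial_div_pow hsA0 2
    simp only [Nat.factorial, Nat.succ_eq_add_one, Nat.cast_mul, Nat.cast_one] at h
    refine h.trans ?_
    rw [div_le_div_iff₀ (by positivity) ht0]
    -- `2 t ≤ 18 ε⁻² s_A²` from `s_A ≥ ε √t/3`
    have h3 : (ε * Real.sqrt t / 3) ^ 2 ≤ sA ^ 2 := pow_le_pow_left₀ (by positivity) hsA1 2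
    have h4 : (ε * Real.sqrt t / 3) ^ 2 = ε ^ 2 * t / 9 := by rw [div_pow, mul_pow, Real.sq_sqrt ht0.le]; ring
    have h5 : ε⁻¹ ^ 2 * (ε ^ 2 * t / 9) = t / 9 := by field_simp
    have h6 : t / 9 ≤ ε⁻¹ ^ 2 * sA ^ 2 := by
      have := mul_le_mul_of_nonneg_left h3 (by positivity : (0:ℝ) ≤ ε⁻¹ ^ 2)
      rwa [h4, h5] at this
    linarith
  have hE2 : Real.exp (-sA) ≤ 1944 * ε⁻¹ ^ 4 / t ^ 2 := by
    have h := exp_neg_le_factorial_div_pow hsA0 4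
    simp only [Nat.factorial, Nat.succ_eq_add_one, Nat.cast_mul, Nat.cast_one] at h
    refine h.trans ?_
    rw [div_le_div_iff₀ (by positivity) (by positivity)]
    have h3 : (ε * Real.sqrt t / 3) ^ 4 ≤ sA ^ 4 := pow_le_pow_left₀ (by positivity) hsA1 4
    have hst : Real.sqrt t ^ 4 = t ^ 2 := by
      rw [show (4:ℕ) = 2 * 2 from rfl, pow_mul, Real.sq_sqrt ht0.le]
    have h4 : (ε * Real.sqrt t / 3) ^ 4 = ε ^ 4 * t ^ 2 / 81 := by rw [div_pow, mul_pow, hst]; ring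
    have h5 : ε⁻¹ ^ 4 * (ε ^ 4 * t ^ 2 / 81) = t ^ 2 / 81 := by field_simp
    have h6 : t ^ 2 / 81 ≤ ε⁻¹ ^ 4 * sA ^ 4 := by
      have := mul_le_mul_of_nonneg_left h3 (by positivity : (0:ℝ) ≤ ε⁻¹ ^ 4)
      rwa [h4, h5] at this
    linarith
  have hE3 : Real.exp (-sA) ≤ 1 := Real.exp_le_one_iff.mpr (by linarith)
  have ha0 : 0 ≤ a := by positivity
  have hcoef : 2 * (1 + K / Real.log 2) ^ (10 : ℕ) * Real.exp 10 ≤ 3.44e8 * K ^ 10 := by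
    have h := mul_le_mul hKp he10 (Real.exp_pos _).le (by positivity : (0:ℝ) ≤ 7800 * K ^ 10)
    have hK10 : 0 ≤ K ^ 10 := pow_nonneg hK0 10
    linarith
  have haE : a = 2 * (1 + K / Real.log 2) ^ (10 : ℕ) * Real.exp 10 * Real.exp (-sA) := by rw [ha, hexp]; ring
  have hc0 : 0 ≤ 2 * (1 + K / Real.log 2) ^ (10 : ℕ) * Real.exp 10 := by positivity
  refine ⟨a, ha0, ?_, ?_, ?_, ?_, ?_⟩
  · rw [haE]
    have h0 : 0 ≤ K ^ 10 * ε⁻¹ ^ 2 / t := by positivity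
    calc _ ≤ 3.44e8 * K ^ 10 * (18 * ε⁻¹ ^ 2 / t) := mul_le_mul hcoef hE1 (Real.exp_pos _).le (by positivity)
      _ = 6.192e9 * (K ^ 10 * ε⁻¹ ^ 2 / t) := by ring
      _ ≤ 2.5e10 * (K ^ 10 * ε⁻¹ ^ 2 / t) := mul_le_mul_of_nonneg_right (by norm_num) h0
      _ = _ := by ring
  · rw [haE]
    have h0 : 0 ≤ K ^ 10 * ε⁻¹ ^ 4 / t ^ 2 := by positivity
    calc _ ≤ 3.44e8 * K ^ 10 * (1944 * ε⁻¹ ^ 4 / t ^ 2) := mul_le_mul hcoef hE2 (Real.exp_pos _).le (by positivity)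
      _ = 6.68736e11 * (K ^ 10 * ε⁻¹ ^ 4 / t ^ 2) := by ring
      _ ≤ 1.1e13 * (K ^ 10 * ε⁻¹ ^ 4 / t ^ 2) := mul_le_mul_of_nonneg_right (by norm_num) h0
      _ = _ := by ring
  · rw [haE]
    have h0 : 0 ≤ K ^ 10 := by positivity
    calc _ ≤ 3.44e8 * K ^ 10 * 1 := mul_le_mul hcoef hE3 (Real.exp_pos _).le (by positivity)
      _ ≤ _ := by linarith
  · have := (abs_le.mp (hA 1)).2
    rw [PhiA]; linarith
  · have := (abs_le.mp (hA 0)).1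
    rw [PhiA]; linarith

/-- **The middle level in the main regime**: `G_B⁺ ≤ V_B(1 + b)`, `G_B⁻ ≥ V_B(1 − b)` with
`b = (C_d + (K/log w₁)e^{14}) e^{−2/(3ε)}`, its three bounds, and `V_B⁻² ≤ 2 + 8 ε⁴ log D`. [folklore] -/
theorem levelB_bounds (hε3 : ε ≤ 1 / 3) (hKu : 200 * K ≤ ε ^ 2 * Real.log D)
    (hKw : 200 * K ≤ Real.sqrt (Real.log D)) {Cd : ℝ} (hCd : 0 ≤ Cd)
    (hCdF : ∀ s : ℝ, 1 ≤ s → |upperSieveFun 1 s - 1| ≤ Cd * Real.exp (-s))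
    (hCdf : ∀ s : ℝ, 2 ≤ s → |lowerSieveFun 1 s - 1| ≤ Cd * Real.exp (-s)) {z : ℝ} (hz : 2 ≤ z) :
    ∃ b : ℝ, 0 ≤ b ∧ b ≤ (1.5 * Cd + 9021) * ε ∧ b ≤ Cd + 6014 ∧ b * ε⁻¹ ^ 4 ≤ 912 * (Cd + 6014) * ε ∧
      GB (D := D) (ε := ε) g 1 z ≤ BetaSieve.vprod g (primesProdIco (w1 D ε) (zS (D := D) (ε := ε) z)) * (1 + b) ∧
      BetaSieve.vprod g (primesProdIco (w1 D ε) (zS (D := D) (ε := ε) z)) * (1 - b) ≤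
        GB (D := D) (ε := ε) g 0 z ∧
      (BetaSieve.vprod g (primesProdIco (w1 D ε) (zS (D := D) (ε := ε) z)))⁻¹ ^ 2 ≤ 2 + 8 * ε ^ 4 * Real.log D := by
  have hK0 : 0 ≤ K := by linarith
  set t := Real.log D with ht
  have ht0 : 0 < t := Real.log_pos hD
  have hε2t : 200 ≤ ε ^ 2 * t := le_trans (by linarith) hKu
  have hsqrt : 200 ≤ Real.sqrt t := le_trans (by linarith) hKw
  obtain ⟨hw2, hKw', hlw1⟩ := w1_props hD hε hKu (by linarith) hKw (by linarith)
  obtain ⟨hu2, -⟩ := uu_props hD hε hKu (by linarith)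
  obtain ⟨-, hlevB1, -, -⟩ := levels_basic hD hε hε3
  obtain ⟨-, huB, hu2B⟩ := uu_le_levels hD hε hε3
  set w := w1 D ε with hw
  set y := zS (D := D) (ε := ε) z with hy
  have hy2 : 2 ≤ y := le_min hz hu2
  have hyu : y ≤ uu D ε := min_le_right _ _
  have hy0 : 0 < y := by linarith
  have hε3' : 3 ≤ ε⁻¹ := by rw [le_inv_comm₀ (by norm_num) hε]; linarith
  set s₀ : ℝ := 2 / 3 * ε⁻¹ with hs₀
  have hs₀2 : 2 ≤ s₀ := by rw [hs₀]; linarith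
  have hs₀0 : 0 < s₀ := by linarith
  have hKw0 : 0 ≤ K / Real.log w := div_nonneg hK0 (by linarith)
  set b := (Cd + K / Real.log w * Real.exp 14) * Real.exp (-s₀) with hb
  have hb0 : 0 ≤ b := by positivity
  -- `e^{-s₀}` bounds
  have he1 : Real.exp (-s₀) ≤ 1.5 * ε := by
    have h := exp_neg_le_factorial_div_pow hs₀0 1
    rw [show ((Nat.factorial 1 : ℕ) : ℝ) = 1 by norm_num [Nat.factorial], pow_one] at h
    refine h.trans (le_of_eq ?_)
    rw [hs₀]; field_simp; norm_num
  have he5 : Real.exp (-s₀) * ε⁻¹ ^ 4 ≤ 912 * ε := by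
    have h := exp_neg_le_factorial_div_pow hs₀0 5
    rw [show ((Nat.factorial 5 : ℕ) : ℝ) = 120 by norm_num [Nat.factorial]] at h
    have heq : (120 : ℝ) / s₀ ^ 5 * ε⁻¹ ^ 4 = 911.25 * ε := by rw [hs₀]; field_simp; norm_num
    calc Real.exp (-s₀) * ε⁻¹ ^ 4 ≤ 120 / s₀ ^ 5 * ε⁻¹ ^ 4 := mul_le_mul_of_nonneg_right h (by positivity)
      _ = 911.25 * ε := heq
      _ ≤ 912 * ε := by nlinarith
  have he0 : Real.exp (-s₀) ≤ 1 := Real.exp_le_one_iff.mpr (by linarith)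
  have hcoef : Cd + K / Real.log w * Real.exp 14 ≤ Cd + 6014 := by
    have := mul_le_mul hKw' exp_fourteen_le (Real.exp_pos _).le (by norm_num)
    linarith
  have hcoef0 : 0 ≤ Cd + K / Real.log w * Real.exp 14 := by positivity
  have hb1 : b ≤ (1.5 * Cd + 9021) * ε := by
    calc b ≤ (Cd + 6014) * (1.5 * ε) := mul_le_mul hcoef he1 (Real.exp_pos _).le (by positivity)
      _ = (1.5 * Cd + 9021) * ε := by ring
  have hb2 : b ≤ Cd + 6014 := by
    calc b ≤ (Cd + 6014) * 1 := mul_le_mul hcoef he0 (Real.exp_pos _).le (by positivity)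
      _ = Cd + 6014 := mul_one _
  have hb3 : b * ε⁻¹ ^ 4 ≤ 912 * (Cd + 6014) * ε := by
    rw [hb, mul_assoc]
    calc _ ≤ (Cd + 6014) * (912 * ε) := mul_le_mul hcoef he5 (by positivity) (by positivity)
      _ = _ := by ring
  -- `V_B`
  set VB := BetaSieve.vprod g (primesProdIco w y) with hVB
  have hVBpos : 0 < VB := vprod_pos_of_lt_one fun p hp => (h01 p (Nat.prime_of_mem_primeFactors hp)).2
  have hVB1 : VB ≤ 1 := vprod_Ico_le_one h01 _ _
  rcases le_or_gt y w with hyw | hwy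
  · -- empty middle range
    have hP : primesProdIco w y = 1 := primesProdIco_eq_one_of_le hyw
    have hV1 : VB = 1 := by rw [hVB, hP]; simp [BetaSieve.vprod]
    have hG : ∀ par, GB (D := D) (ε := ε) g par z = 1 := by
      intro par; rw [GB, ← hy, ← hw, hP, BetaSieve.mainSum_one hg]
    refine ⟨b, hb0, hb1, hb2, hb3, ?_, ?_, ?_⟩
    · rw [hG, hV1]; linarith
    · rw [hG, hV1]; linarith
    · rw [hV1, inv_one, one_pow]; nlinarith [pow_nonneg hε.le 4]
  · -- the Jurkat–Richert bounds at level `D^{2ε/3}`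
    have hyℓ : y ≤ levB D ε := hyu.trans huB
    have hy2ℓ : y ^ 2 ≤ levB D ε := le_trans (pow_le_pow_left₀ hy0.le hyu 2) hu2B
    have hU := mainSum_one_Ico_le hg hK0 h1 h01 hw2 hy2 hyℓ hKw'
    have hL := le_mainSum_zero_Ico hg hK0 h1 h01 hw2 hy2 hy2ℓ hKw'
    obtain ⟨sB, hsB⟩ : ∃ sB : ℝ, sB = Real.log (levB D ε) / Real.log y := ⟨_, rfl⟩
    rw [← hsB] at hU hL
    have hlogy0 : 0 < Real.log y := Real.log_pos (by linarith)
    have hlogyu : Real.log y ≤ ε ^ 2 * t := by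
      rw [← log_uu (ε := ε) hD]; exact Real.log_le_log hy0 hyu
    have hsB0 : s₀ ≤ sB := by
      rw [hsB, log_levB (ε := ε) hD, le_div_iff₀ hlogy0]
      calc s₀ * Real.log y ≤ s₀ * (ε ^ 2 * t) := mul_le_mul_of_nonneg_left hlogyu hs₀0.le
        _ = 2 * ε / 3 * t := by rw [hs₀]; field_simp
    have hsB2 : 2 ≤ sB := hs₀2.trans hsB0
    have heB : Real.exp (-sB) ≤ Real.exp (-s₀) := Real.exp_le_exp.mpr (by linarith)
    have he14 : Real.exp (14 - sB) = Real.exp 14 * Real.exp (-sB) := by rw [← Real.exp_add]; ring_nf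
    have hF := (abs_le.mp (hCdF sB (by linarith))).2
    have hf := (abs_le.mp (hCdf sB hsB2)).1
    have hkey : Cd * Real.exp (-sB) + K / Real.log w * Real.exp (14 - sB) ≤ b := by
      rw [he14, hb, add_mul]
      have h1' : Cd * Real.exp (-sB) ≤ Cd * Real.exp (-s₀) := mul_le_mul_of_nonneg_left heB hCd
      have h2' : K / Real.log w * (Real.exp 14 * Real.exp (-sB)) ≤ K / Real.log w * Real.exp 14 * Real.exp (-s₀) := by
        rw [← mul_assoc]; exact mul_le_mul_of_nonneg_left heB (by positivity)
      linarith
    refine ⟨b, hb0, hb1, hb2, hb3, ?_, ?_, ?_⟩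
    · rw [GB, ← hy, ← hw]
      refine hU.trans ?_
      refine mul_le_mul_of_nonneg_left ?_ hVBpos.le
      linarith
    · rw [GB, ← hy, ← hw]
      refine le_trans ?_ hL
      refine mul_le_mul_of_nonneg_left ?_ hVBpos.le
      linarith
    · -- `V_B⁻¹ ≤ (log y/log w)(1 + K/log w) ≤ 1.005 · max(ε²√t, 1)`
      have hVi := inv_vprod_Ico_le (g := g) (K := K) h1 hw2 hwy
      have hlogw := log_w1 hD hε
      have hK' : 1 + K / Real.log w ≤ 1.005 := by linarith
      have hsqt : Real.sqrt t * Real.sqrt t = t := Real.mul_self_sqrt ht0.le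
      have hratio : Real.log y / Real.log w ≤ max (ε ^ 2 * Real.sqrt t) 1 := by
        rw [div_le_iff₀ (by linarith)]
        rcases le_total (Real.sqrt t) (ε ^ 2 * t) with h | h
        · have hlw : Real.log w = Real.sqrt t := by rw [hw, hlogw, min_eq_left h]
          rw [hlw]
          calc Real.log y ≤ ε ^ 2 * t := hlogyu
            _ = ε ^ 2 * Real.sqrt t * Real.sqrt t := by rw [mul_assoc, hsqt]
            _ ≤ max (ε ^ 2 * Real.sqrt t) 1 * Real.sqrt t :=
                mul_le_mul_of_nonneg_right (le_max_left _ _) (Real.sqrt_nonneg _)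
        · have hlw : Real.log w = ε ^ 2 * t := by rw [hw, hlogw, min_eq_right h]
          rw [hlw]
          calc Real.log y ≤ 1 * (ε ^ 2 * t) := by rw [one_mul]; exact hlogyu
            _ ≤ max (ε ^ 2 * Real.sqrt t) 1 * (ε ^ 2 * t) :=
                mul_le_mul_of_nonneg_right (le_max_right _ _) (by positivity)
      have hVi' : VB⁻¹ ≤ max (ε ^ 2 * Real.sqrt t) 1 * 1.005 :=
        hVi.trans (mul_le_mul hratio hK' (by positivity) (le_trans zero_le_one (le_max_right _ _)))
      have hsq : VB⁻¹ ^ 2 ≤ (max (ε ^ 2 * Real.sqrt t) 1 * 1.005) ^ 2 :=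
        pow_le_pow_left₀ (inv_nonneg.mpr hVBpos.le) hVi' 2
      have hε4t : 0 ≤ ε ^ 4 * t := by positivity
      have hmax : (max (ε ^ 2 * Real.sqrt t) 1) ^ 2 ≤ ε ^ 4 * t + 1 := by
        rcases le_total (ε ^ 2 * Real.sqrt t) 1 with h | h
        · rw [max_eq_right h, one_pow]; linarith
        · rw [max_eq_left h]
          have : (ε ^ 2 * Real.sqrt t) ^ 2 = ε ^ 4 * t := by rw [mul_pow, Real.sq_sqrt ht0.le]; ring
          linarith
      calc VB⁻¹ ^ 2 ≤ (max (ε ^ 2 * Real.sqrt t) 1 * 1.005) ^ 2 := hsq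
        _ = (max (ε ^ 2 * Real.sqrt t) 1) ^ 2 * 1.005 ^ 2 := mul_pow _ _ _
        _ ≤ (ε ^ 4 * t + 1) * 1.005 ^ 2 := mul_le_mul_of_nonneg_right hmax (by positivity)
        _ ≤ 2 + 8 * ε ^ 4 * t := by linarith

set_option maxHeartbeats 1600000 in
/-- **The box level in the main regime**: `M_C⁺ ≤ V_C(F(s_C) + c) + σ` and, for `z² ≤ D`,
`M_C⁻ ≥ V_C(f(s_C) − c) − σ`, with `c = (K/log u) e^{14 − s_C}`, `σ = Γ W_C²`, and the bounds on `c`,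
`σ V_C⁻¹` and `V_C⁻¹`. [cite: IwaniecActaArith1980b, §5 pp. 317–319] -/
theorem levelC_bounds (hε3 : ε ≤ 1 / 3) (hKu : 200 * K ≤ ε ^ 2 * Real.log D) {z : ℝ} (hz : 2 ≤ z) (hzD : z ≤ D) :
    ∃ c σ : ℝ, 0 ≤ c ∧ 0 ≤ σ ∧ c ≤ 4.5e5 * K * ε⁻¹ ^ 2 / Real.log D ∧ c ≤ 2213 ∧
      σ * (BetaSieve.vprod g (primesProdIco (uu D ε) z))⁻¹ ≤ 0.34 * ε + 1.02 * K * ε⁻¹ ^ 8 / Real.log D ∧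
      (BetaSieve.vprod g (primesProdIco (uu D ε) z))⁻¹ ≤ 2 * ε⁻¹ ^ 2 ∧
      MC hD hε g 1 z ≤ BetaSieve.vprod g (primesProdIco (uu D ε) z) *
          (upperSieveFun 1 (Real.log D / Real.log z) + c) + σ ∧
      (z ^ 2 ≤ D → BetaSieve.vprod g (primesProdIco (uu D ε) z) *
          (lowerSieveFun 1 (Real.log D / Real.log z) - c) - σ ≤ MC hD hε g 0 z) := by
  have hK0 : 0 ≤ K := by linarith
  set t := Real.log D with ht
  have ht0 : 0 < t := Real.log_pos hD
  have hε2t : 200 ≤ ε ^ 2 * t := le_trans (by linarith) hKu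
  obtain ⟨hu2, hKu'⟩ := uu_props hD hε hKu (by linarith)
  set u := uu D ε with hu
  have hlogu : Real.log u = ε ^ 2 * t := log_uu (ε := ε) hD
  have hz0 : 0 < z := by linarith
  have hlogz : Real.log z ≤ t := Real.log_le_log hz0 hzD
  have hlogz0 : 0 < Real.log z := Real.log_pos (by linarith)
  set sC := t / Real.log z with hsC
  have hsC1 : 1 ≤ sC := by rw [hsC, le_div_iff₀ hlogz0]; linarith
  have hε3' : 3 ≤ ε⁻¹ := by rw [le_inv_comm₀ (by norm_num) hε]; linarith
  set VC := BetaSieve.vprod g (primesProdIco u z) with hVC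
  have hVCpos : 0 < VC := vprod_pos_of_lt_one fun p hp => (h01 p (Nat.prime_of_mem_primeFactors hp)).2
  have hVC1 : VC ≤ 1 := vprod_Ico_le_one h01 _ _
  -- `V_C⁻¹ ≤ 1.005 ε⁻²`
  have hVCi : VC⁻¹ ≤ 1.005 * ε⁻¹ ^ 2 := by
    rcases le_or_gt z u with hzu | huz
    · have hP : primesProdIco u z = 1 := primesProdIco_eq_one_of_le hzu
      have hV1 : VC = 1 := by rw [hVC, hP]; simp [BetaSieve.vprod]
      rw [hV1, inv_one]
      nlinarith
    · refine (inv_vprod_Ico_le (g := g) (K := K) h1 hu2 huz).trans ?_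
      rw [hlogu]
      have hK' : 1 + K / (ε ^ 2 * t) ≤ 1.005 := by rw [hlogu] at hKu'; linarith
      have : Real.log z / (ε ^ 2 * t) ≤ ε⁻¹ ^ 2 := by
        rw [div_le_iff₀ (by positivity)]
        calc Real.log z ≤ t := hlogz
          _ = ε⁻¹ ^ 2 * (ε ^ 2 * t) := by field_simp
      calc Real.log z / (ε ^ 2 * t) * (1 + K / (ε ^ 2 * t)) ≤ ε⁻¹ ^ 2 * 1.005 :=
            mul_le_mul this hK' (by positivity) (by positivity)
        _ = 1.005 * ε⁻¹ ^ 2 := mul_comm _ _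
  -- `c`
  have hKu0 : 0 ≤ K / Real.log u := div_nonneg hK0 (by rw [hlogu]; positivity)
  set c := K / Real.log u * Real.exp (14 - sC) with hc
  have hc0 : 0 ≤ c := by positivity
  have he13 : Real.exp (14 - sC) ≤ Real.exp 13 := Real.exp_le_exp.mpr (by linarith)
  have hc13 : c ≤ K / Real.log u * 442414 :=
    (mul_le_mul_of_nonneg_left he13 hKu0).trans (mul_le_mul_of_nonneg_left exp_thirteen_le hKu0)
  have hc1 : c ≤ 4.5e5 * K * ε⁻¹ ^ 2 / t := by
    refine hc13.trans ?_
    rw [hlogu]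
    have h0 : 0 ≤ K / (ε ^ 2 * t) := by positivity
    have : 4.5e5 * K * ε⁻¹ ^ 2 / t = 4.5e5 * (K / (ε ^ 2 * t)) := by field_simp
    rw [this]; linarith
  have hc2 : c ≤ 2213 := by
    refine hc13.trans ?_
    have := mul_le_mul_of_nonneg_right hKu' (by norm_num : (0:ℝ) ≤ 442414)
    linarith
  -- `σ`
  set WCz := WC (D := D) (ε := ε) g z with hWCz
  have hη : 0 < eta ε := eta_pos hε
  set Γ := (eta ε / (3 * (1 + eta ε)) * Real.log D + K) / Real.log u with hΓ
  have hΓ0 : 0 ≤ Γ := by rw [hΓ, hlogu]; positivity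
  set σ := Γ * WCz ^ 2 with hσ
  have hσ0 : 0 ≤ σ := by positivity
  have hWC0 : 0 ≤ WCz :=
    Finset.sum_nonneg fun d hd => g_nonneg_of_dvd h01 (squarefree_primesProdIco _ _) hg hd
  have hWCle : WCz ≤ VC⁻¹ := (WC_WB_le (D := D) (ε := ε) hg h01 z).1
  have hΓle : Γ ≤ ε ^ 7 / 3 + K * ε⁻¹ ^ 2 / t := by
    rw [hΓ, hlogu, div_le_iff₀ (by positivity)]
    have h1' : eta ε / (3 * (1 + eta ε)) ≤ eta ε / 3 :=
      div_le_div_of_nonneg_left hη.le (by norm_num) (by linarith)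
    have h2' : eta ε / (3 * (1 + eta ε)) * t ≤ eta ε / 3 * t := mul_le_mul_of_nonneg_right h1' ht0.le
    have h3' : (ε ^ 7 / 3 + K * ε⁻¹ ^ 2 / t) * (ε ^ 2 * t) = eta ε / 3 * t + K := by
      rw [eta]; field_simp
    rw [h3']; linarith
  have hσVC : σ * VC⁻¹ ≤ 0.34 * ε + 1.02 * K * ε⁻¹ ^ 8 / t := by
    have hW2 : WCz ^ 2 ≤ VC⁻¹ ^ 2 := pow_le_pow_left₀ hWC0 hWCle 2
    have hV3 : VC⁻¹ ^ 3 ≤ (1.005 * ε⁻¹ ^ 2) ^ 3 := pow_le_pow_left₀ (by positivity) hVCi 3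
    have hε76 : ε ^ 7 * ε⁻¹ ^ 6 = ε := by field_simp
    calc σ * VC⁻¹ = Γ * (WCz ^ 2 * VC⁻¹) := by rw [hσ]; ring
      _ ≤ Γ * (VC⁻¹ ^ 2 * VC⁻¹) :=
          mul_le_mul_of_nonneg_left (mul_le_mul_of_nonneg_right hW2 (inv_nonneg.mpr hVCpos.le)) hΓ0
      _ = Γ * VC⁻¹ ^ 3 := by ring
      _ ≤ (ε ^ 7 / 3 + K * ε⁻¹ ^ 2 / t) * (1.005 * ε⁻¹ ^ 2) ^ 3 :=
          mul_le_mul hΓle hV3 (pow_nonneg (inv_nonneg.mpr hVCpos.le) 3) (by positivity)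
      _ = 1.005 ^ 3 / 3 * (ε ^ 7 * ε⁻¹ ^ 6) + 1.005 ^ 3 * (K * ε⁻¹ ^ 8 / t) := by ring
      _ = 1.005 ^ 3 / 3 * ε + 1.005 ^ 3 * (K * ε⁻¹ ^ 8 / t) := by rw [hε76]
      _ ≤ 0.34 * ε + 1.02 * (K * ε⁻¹ ^ 8 / t) := by
        have h0 : 0 ≤ K * ε⁻¹ ^ 8 / t := by positivity
        have h3 : (1.005 : ℝ) ^ 3 = 1.015075125 := by norm_num
        rw [h3]
        linarith [hε.le]
      _ = _ := by ring
  have hVC2 : VC⁻¹ ≤ 2 * ε⁻¹ ^ 2 := hVCi.trans (by nlinarith [pow_nonneg (inv_pos.mpr hε).le 2])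
  -- `F ≥ 1`, `f ≤ 1`
  have hF1 : 1 ≤ upperSieveFun 1 sC := by
    have := BetaSieve.Iwaniec1980_lemma18_holds.one_le_upper (by norm_num : (1:ℝ) / 2 ≤ 1)
      JurkatRichert.isGreatestBetaSieveData_linear (s := sC) (by linarith)
    simpa using this
  refine ⟨c, σ, hc0, hσ0, hc1, hc2, hσVC, hVC2, ?_, ?_⟩
  · rcases le_or_gt z u with hzu | huz
    · have hP : primesProdIco u z = 1 := primesProdIco_eq_one_of_le hzu
      have hM : MC hD hε g 1 z = 1 := by
        rw [MC, ← hu, hP]; simp [lamC, BetaSieve.indC_one, hg.map_one]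
      have hV1 : VC = 1 := by rw [hVC, hP]; simp [BetaSieve.vprod]
      rw [hM, hV1, one_mul]; linarith
    · have hstrip := abs_rosserMain_sub_boxMain_le hD hε (eta_pos hε) hg hK0 h1 h01
        (show 2 ≤ grid D ε (eta ε) 0 from hu2) 1 z
      have hR := mainSum_one_Ico_le hg hK0 h1 h01 hu2 hz hzD hKu'
      have hdiff : BetaSieve.mainSum 1 g 2 D (primesProdIco u z) - MC hD hε g 1 z =
          ∑ t ∈ (primesProdIco (grid D ε (eta ε) 0) z).divisors,
            (μ t : ℝ) * (BetaSieve.ind 1 2 D t -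
              BetaSieve.indC 1 (fun t => condK (D := D) (ε := ε) (η := eta ε) (pat hD hε (eta_pos hε) t)) t) *
              g t := by
        rw [BetaSieve.mainSum, MC, ← hu, show grid D ε (eta ε) 0 = u from rfl, ← Finset.sum_sub_distrib]
        refine Finset.sum_congr rfl fun t _ => ?_
        rw [lamC]; ring
      rw [← hdiff] at hstrip
      have := (abs_le.mp hstrip).1
      -- `MC ≤ rosser⁺ + Γ W²`
      have hrw : (eta ε / (3 * (1 + eta ε)) * Real.log D + K) / Real.log (grid D ε (eta ε) 0) *
          (∑ d ∈ (primesProdIco (grid D ε (eta ε) 0) z).divisors, g d) ^ 2 = σ := by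
        rw [hσ, hΓ, hWCz, WC]; rfl
      rw [hrw] at this
      linarith
  · intro hz2D
    have hsC2 : 2 ≤ sC := by
      rw [hsC, le_div_iff₀ hlogz0]
      have : Real.log (z ^ 2) ≤ t := Real.log_le_log (by positivity) hz2D
      rw [Real.log_pow] at this; push_cast at this; linarith
    have hf1 : lowerSieveFun 1 sC ≤ 1 := by
      have := BetaSieve.Iwaniec1980_lemma18_holds.lower_le_one (by norm_num : (1:ℝ) / 2 ≤ 1)
        JurkatRichert.isGreatestBetaSieveData_linear (s := sC)
          (by show siftingLimit 1 ≤ sC; rw [siftingLimit_one_holds]; exact hsC2)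
      simpa using this
    rcases le_or_gt z u with hzu | huz
    · have hP : primesProdIco u z = 1 := primesProdIco_eq_one_of_le hzu
      have hM : MC hD hε g 0 z = 1 := by
        rw [MC, ← hu, hP]; simp [lamC, BetaSieve.indC_one, hg.map_one]
      have hV1 : VC = 1 := by rw [hVC, hP]; simp [BetaSieve.vprod]
      rw [hM, hV1, one_mul]; linarith
    · have hstrip := abs_rosserMain_sub_boxMain_le hD hε (eta_pos hε) hg hK0 h1 h01
        (show 2 ≤ grid D ε (eta ε) 0 from hu2) 0 z
      have hR := le_mainSum_zero_Ico hg hK0 h1 h01 hu2 hz hz2D hKu'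
      have hdiff : BetaSieve.mainSum 0 g 2 D (primesProdIco u z) - MC hD hε g 0 z =
          ∑ t ∈ (primesProdIco (grid D ε (eta ε) 0) z).divisors,
            (μ t : ℝ) * (BetaSieve.ind 0 2 D t -
              BetaSieve.indC 0 (fun t => condK (D := D) (ε := ε) (η := eta ε) (pat hD hε (eta_pos hε) t)) t) *
              g t := by
        rw [BetaSieve.mainSum, MC, ← hu, show grid D ε (eta ε) 0 = u from rfl, ← Finset.sum_sub_distrib]
        refine Finset.sum_congr rfl fun t _ => ?_
        rw [lamC]; ring
      rw [← hdiff] at hstrip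
      have := (abs_le.mp hstrip).2
      have hrw : (eta ε / (3 * (1 + eta ε)) * Real.log D + K) / Real.log (grid D ε (eta ε) 0) *
          (∑ d ∈ (primesProdIco (grid D ε (eta ε) 0) z).divisors, g d) ^ 2 = σ := by
        rw [hσ, hΓ, hWCz, WC]; rfl
      rw [hrw] at this
      linarith

omit hD hε hg hK1 h1 h01 in
/-- **The two-level sandwich** (pure real): from the tiny-level and middle-level brackets and the
cross-term bound, `Φ⁺ ≤ V_T V_B (1 + δ)` and `Φ⁻ ≥ V_T V_B (1 − δ)` with `δ = a + b + ab + 2a V_B⁻²`. [folklore] -/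
theorem phi_sandwich_real {VT VB a b A1 A0 G1 G0 Wb Φ1 Φ0 : ℝ} (hVT : 0 < VT) (hVB : 0 < VB)
    (ha : 0 ≤ a) (hb : 0 ≤ b) (hA1 : A1 ≤ VT * (1 + a)) (hA0 : VT * (1 - a) ≤ A0) (hT0 : A0 ≤ VT)
    (hB1 : G1 ≤ VB * (1 + b)) (hB0 : VB * (1 - b) ≤ G0) (hG0 : G0 ≤ VB) (hG1 : VB ≤ G1)
    (hWb : Wb ≤ VB⁻¹) (hWb0 : 0 ≤ Wb) (hP1 : Φ1 ≤ A1 * G1 + (A1 - A0) * Wb)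
    (hP0 : A0 * G0 - (A1 - A0) * Wb ≤ Φ0) :
    Φ1 ≤ VT * VB * (1 + (a + b + a * b + 2 * a * VB⁻¹ ^ 2)) ∧
      VT * VB * (1 - (a + b + a * b + 2 * a * VB⁻¹ ^ 2)) ≤ Φ0 := by
  have hVB0 : VB ≠ 0 := hVB.ne'
  have hdA : A1 - A0 ≤ 2 * a * VT := by linarith
  have hcross : (A1 - A0) * Wb ≤ 2 * a * VT * VB⁻¹ := mul_le_mul hdA hWb hWb0 (by positivity)
  have hab : 0 ≤ a * b := mul_nonneg ha hb
  have hVV : 0 ≤ VT * VB := (mul_pos hVT hVB).le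
  constructor
  · have h1' : A1 * G1 ≤ VT * (1 + a) * (VB * (1 + b)) := mul_le_mul hA1 hB1 (by linarith) (by positivity)
    have hid : VT * (1 + a) * (VB * (1 + b)) + 2 * a * VT * VB⁻¹ =
        VT * VB * (1 + (a + b + a * b + 2 * a * VB⁻¹ ^ 2)) := by
      field_simp; ring
    linarith
  · have hcor := mul_ge_corners ⟨hA0, hT0⟩ ⟨hB0, hG0⟩
    set L := VT * VB * (1 - a - b - a * b) with hL
    have c1 : L ≤ VT * (1 - a) * (VB * (1 - b)) := by
      have : VT * (1 - a) * (VB * (1 - b)) - L = VT * VB * (2 * (a * b)) := by rw [hL]; ring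
      nlinarith [mul_nonneg hVV hab]
    have c2 : L ≤ VT * (1 - a) * VB := by
      have : VT * (1 - a) * VB - L = VT * VB * (b + a * b) := by rw [hL]; ring
      nlinarith [mul_nonneg hVV (add_nonneg hb hab)]
    have c3 : L ≤ VT * (VB * (1 - b)) := by
      have : VT * (VB * (1 - b)) - L = VT * VB * (a + a * b) := by rw [hL]; ring
      nlinarith [mul_nonneg hVV (add_nonneg ha hab)]
    have c4 : L ≤ VT * VB := by
      have : VT * VB - L = VT * VB * (a + b + a * b) := by rw [hL]; ring
      nlinarith [mul_nonneg hVV (add_nonneg (add_nonneg ha hb) hab)]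
    have hmin : L ≤ A0 * G0 := le_trans (le_min (le_min c1 c2) (le_min c3 c4)) hcor
    have hid : L - 2 * a * VT * VB⁻¹ = VT * VB * (1 - (a + b + a * b + 2 * a * VB⁻¹ ^ 2)) := by
      rw [hL]; field_simp; ring
    linarith

omit hD hε hg hK1 h1 h01 in
/-- The final polynomial inequality in the decay constant. [folklore] -/
theorem final_const_le {Cd : ℝ} (hCd : 0 ≤ Cd) :
    (4 + Cd + 2213 + 0.34) * ((5 + (Cd + 6014)) * 9.25e16 + (1.5 * Cd + 9021) + 16 * 4.1e19) + 4.5e5 + 1.36 +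
        1.02 * ((5 + (Cd + 6014)) * 1.4e16 + (Cd + 6014) + 16 * 1e18) +
        8 * ((5 + (Cd + 6014)) * 9.25e16 + 912 * (Cd + 6014) + 16 * 4.1e19) ≤
      5e24 * (1 + Cd) ^ 2 := by
  nlinarith [mul_nonneg hCd hCd]

set_option maxHeartbeats 1600000 in
/-- **The main-term bounds in the main regime** (`2 ≤ z ≤ D`, and `z² ≤ D` for the lower bound):
`∑_{d ∣ P(z)} Λ⁺_z(d) g(d) ≤ V(z) (F(log D/log z) + E)` and `∑_{d ∣ P(z)} Λ⁻_z(d) g(d) ≥ V(z) (f(log D/log z) − E)` with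
`E = 5·10²⁴ (1 + C_d)² (ε + ε⁻⁸ eᴷ / log D)`. [cite: IwaniecActaArith1980b, Lemma 2 and §5 p. 320] -/
theorem main_regime_bounds (hε3 : ε ≤ 1 / 3) (hKu : 200 * K ≤ ε ^ 2 * Real.log D)
    (hKw : 200 * K ≤ Real.sqrt (Real.log D)) (h30 : 30 ≤ ε * Real.sqrt (Real.log D))
    (hsplit : ε⁻¹ ^ 4 < Real.log D ∨ ε ≤ 1 / 30) {Cd : ℝ} (hCd : 0 ≤ Cd)
    (hCdF : ∀ s : ℝ, 1 ≤ s → |upperSieveFun 1 s - 1| ≤ Cd * Real.exp (-s))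
    (hCdf : ∀ s : ℝ, 2 ≤ s → |lowerSieveFun 1 s - 1| ≤ Cd * Real.exp (-s)) {z : ℝ} (hz : 2 ≤ z) (hzD : z ≤ D) :
    (∑ d ∈ (primesProdBelow z).divisors, LamZ hD hε 1 z d * g d ≤
        BetaSieve.vprod g (primesProdBelow z) *
          (upperSieveFun 1 (Real.log D / Real.log z) +
            5e24 * (1 + Cd) ^ 2 * (ε + ε⁻¹ ^ 8 * Real.exp K / Real.log D))) ∧
    (z ^ 2 ≤ D →
      BetaSieve.vprod g (primesProdBelow z) *
          (lowerSieveFun 1 (Real.log D / Real.log z) -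
            5e24 * (1 + Cd) ^ 2 * (ε + ε⁻¹ ^ 8 * Real.exp K / Real.log D)) ≤
        ∑ d ∈ (primesProdBelow z).divisors, LamZ hD hε 0 z d * g d) := by
  have hK0 : 0 ≤ K := by linarith
  have ht0 : 0 < Real.log D := Real.log_pos hD
  have hε2t : 200 ≤ ε ^ 2 * Real.log D := le_trans (by linarith) hKu
  have ht1 : 1 ≤ Real.log D := by
    have : ε ^ 2 ≤ 1 := by nlinarith
    nlinarith
  have hε1 : ε ≤ 1 := by linarith
  obtain ⟨a, ha0, ha1, ha2, ha3, hA1, hA0⟩ := levelA_bounds hD hε hg hK1 h1 h01 hε3 hKu hKw h30 hsplit hz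
  obtain ⟨b, hb0, hb1, hb2, hb3, hB1, hB0, hVB2⟩ := levelB_bounds hD hε hg hK1 h1 h01 hε3 hKu hKw hCd hCdF hCdf hz
  obtain ⟨c, σ, hc0, hσ0, hc1, hc2, hσVC, hVC2, hM1, hM0⟩ := levelC_bounds hD hε hg hK1 h1 h01 hε3 hKu hz hzD
  obtain ⟨⟨hS0, hS1⟩, ⟨hC0, hC1⟩, ⟨hT0, hT1⟩, ⟨hG0, hG1⟩⟩ := sandwiches hD hε hg h01 z
  obtain ⟨hP1, hP0⟩ := PhiS_bounds hD hε hg h01 z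
  obtain ⟨hΛ1, hΛ0⟩ := mainSum_LamZ_bounds hD hε hg h01 z
  obtain ⟨hWC, hWB⟩ := WC_WB_le (D := D) (ε := ε) hg h01 z
  -- names
  set VT := BetaSieve.vprod g (primesProdBelow (zT (D := D) (ε := ε) z)) with hVT
  set VB := BetaSieve.vprod g (primesProdIco (w1 D ε) (zS (D := D) (ε := ε) z)) with hVB
  set VC := BetaSieve.vprod g (primesProdIco (uu D ε) z) with hVC
  set VS := BetaSieve.vprod g (primesProdBelow (zS (D := D) (ε := ε) z)) with hVS
  set Φ1 := PhiS (D := D) (ε := ε) g 1 z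
  set Φ0 := PhiS (D := D) (ε := ε) g 0 z
  set A1 := PhiA (D := D) (ε := ε) g 1 z
  set A0 := PhiA (D := D) (ε := ε) g 0 z
  set G1 := GB (D := D) (ε := ε) g 1 z
  set G0 := GB (D := D) (ε := ε) g 0 z
  set W := WC (D := D) (ε := ε) g z
  set WBz := WB (D := D) (ε := ε) g z
  have hlt : ∀ P : ℕ, ∀ p ∈ P.primeFactors, g p < 1 := fun P p hp => (h01 p (Nat.prime_of_mem_primeFactors hp)).2
  have hVTpos : 0 < VT := vprod_pos_of_lt_one (hlt _)
  have hVBpos : 0 < VB := vprod_pos_of_lt_one (hlt _)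
  have hVCpos : 0 < VC := vprod_pos_of_lt_one (hlt _)
  have hVSpos : 0 < VS := vprod_pos_of_lt_one (hlt _)
  have hVB0 : VB ≠ 0 := hVBpos.ne'
  -- `V_S = V_T V_B`, `V(z) = V_S V_C`
  have hTS : zT (D := D) (ε := ε) z ≤ zS (D := D) (ε := ε) z := min_le_min_left z (w1_le_uu D ε)
  have hVS_eq : VS = VT * VB := by
    rw [hVS, vprod_primesProdBelow_mul (g := g) hTS, primesProdIco_zT_zS]
  have hV_eq : BetaSieve.vprod g (primesProdBelow z) = VS * VC := by
    rw [vprod_primesProdBelow_mul (g := g) (show zS (D := D) (ε := ε) z ≤ z from min_le_left _ _), primesProdIco_zS]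
  have hWB0 : 0 ≤ WBz :=
    Finset.sum_nonneg fun d hd => g_nonneg_of_dvd h01 (squarefree_primesProdIco _ _) hg hd
  have hW0 : 0 ≤ W :=
    Finset.sum_nonneg fun d hd => g_nonneg_of_dvd h01 (squarefree_primesProdIco _ _) hg hd
  -- the sieve functions at `s_C = log D/log z`
  obtain ⟨s, hs⟩ : ∃ s : ℝ, s = Real.log D / Real.log z := ⟨_, rfl⟩
  rw [← hs] at hM1 hM0 ⊢
  have hlogz0 : 0 < Real.log z := Real.log_pos (by linarith)
  have hs1 : 1 ≤ s := by
    rw [hs, le_div_iff₀ hlogz0, one_mul]; exact Real.log_le_log (by linarith) hzD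
  obtain ⟨hF1, hF4⟩ := upperSieveFun_bounds hCd hCdF hs1
  -- the error pieces
  obtain ⟨hK11, hK10, hK1e⟩ := pow_exp_bounds hK0
  have hpieces := err_pieces_real (a := a) (b := b) (c := c) (σC := σ * VC⁻¹) (VCi := VC⁻¹) (VBi2 := VB⁻¹ ^ 2)
    hε hε1 ht1 hK1 hCd ha0 ha1 ha2 ha3 hb0 hb1 hb2 hb3 hc1 hσVC (inv_nonneg.mpr hVCpos.le) hVC2
    (by positivity) hVB2 hK11 hK10 hK1e
  obtain ⟨hErr0, hcE, hσE, hδ0, hδE, hδσE, hδVE⟩ := hpieces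
  obtain ⟨hΦ1, hΦ0⟩ := phi_sandwich_real hVTpos hVBpos ha0 hb0 hA1 hA0 hT0 hB1 hB0 hG0 hG1 hWB hWB0 hP1 hP0
  rw [← hVS_eq] at hΦ1 hΦ0
  obtain ⟨Err, hErr⟩ : ∃ Err : ℝ, Err = ε + ε⁻¹ ^ 8 * Real.exp K / Real.log D := ⟨_, rfl⟩
  rw [← hErr] at hErr0 hcE hσE hδE hδσE hδVE ⊢
  obtain ⟨δ, hδ⟩ : ∃ δ : ℝ, δ = a + b + a * b + 2 * a * VB⁻¹ ^ 2 := ⟨_, rfl⟩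
  rw [← hδ] at hδ0 hδE hδσE hδVE hΦ1 hΦ0
  have hΦdiff : Φ1 - Φ0 ≤ 2 * δ * VS := by linarith
  set Cδ := (5 + (Cd + 6014)) * 9.25e16 + (1.5 * Cd + 9021) + 16 * 4.1e19 with hCδ
  set C3 := (5 + (Cd + 6014)) * 1.4e16 + (Cd + 6014) + 16 * 1e18 with hC3
  set C4 := (5 + (Cd + 6014)) * 9.25e16 + 912 * (Cd + 6014) + 16 * 4.1e19 with hC4
  have hfin : (4 + Cd + 2213 + 0.34) * Cδ + 4.5e5 + 1.36 + 1.02 * C3 + 8 * C4 ≤ 5e24 * (1 + Cd) ^ 2 :=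
    final_const_le hCd
  have hCδ0 : 0 ≤ Cδ * Err := by positivity
  have hδc : δ * c ≤ 2213 * (Cδ * Err) :=
    (mul_le_mul_of_nonneg_left hc2 hδ0).trans (by rw [mul_comm]; exact mul_le_mul_of_nonneg_left hδE (by norm_num))
  have hbig : ((4 + Cd + 2213 + 0.34) * Cδ + 4.5e5 + 1.36 + 1.02 * C3 + 8 * C4) * Err ≤
      5e24 * (1 + Cd) ^ 2 * Err := mul_le_mul_of_nonneg_right hfin hErr0
  set F := upperSieveFun 1 s with hF
  constructor
  · -- upper bound
    have hδF : δ * F ≤ (4 + Cd) * (Cδ * Err) :=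
      (mul_le_mul_of_nonneg_left hF4 hδ0).trans (by rw [mul_comm]; exact mul_le_mul_of_nonneg_left hδE (by linarith))
    have halg := algebra_upper (F := F) hVSpos hVCpos hδ0 hΦ1 hΦdiff hM1 (hVCpos.le.trans hC1) hWC hW0
    have hE1 : δ * F + (1 + δ) * c + (1 + δ) * σ * VC⁻¹ + 2 * δ * VC⁻¹ ^ 2 ≤
        5e24 * (1 + Cd) ^ 2 * Err := by
      have h1' : (1 + δ) * σ * VC⁻¹ = σ * VC⁻¹ + δ * (σ * VC⁻¹) := by ring
      have h2' : (1 + δ) * c = c + δ * c := by ring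
      have h3' : ((4 + Cd + 2213 + 0.34) * Cδ + 4.5e5 + 1.36 + 1.02 * C3 + 8 * C4) * Err =
          (4 + Cd) * (Cδ * Err) + 2213 * (Cδ * Err) + 0.34 * (Cδ * Err) + 4.5e5 * Err + 1.36 * Err +
            1.02 * (C3 * Err) + 8 * (C4 * Err) := by ring
      rw [h1', h2']
      linarith
    rw [hV_eq]
    refine hΛ1.trans (halg.trans ?_)
    exact mul_le_mul_of_nonneg_left (by linarith) (mul_pos hVSpos hVCpos).le
  · -- lower bound
    intro hz2D
    have hs2 : 2 ≤ s := by
      rw [hs, le_div_iff₀ hlogz0]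
      have : Real.log (z ^ 2) ≤ Real.log D := Real.log_le_log (by positivity) hz2D
      rw [Real.log_pow] at this; push_cast at this; linarith
    obtain ⟨hf1, hfabs⟩ := lowerSieveFun_bounds hCd hCdf hs2
    set f := lowerSieveFun 1 s with hf
    have halg := algebra_lower (f := f) hVSpos hVCpos hf1 hc0 hσ0 hδ0 hΦ0 hS0 hΦdiff (hM0 hz2D) hC0 hWC hW0
    have hδf : δ * (1 + |f|) ≤ (2 + Cd) * (Cδ * Err) :=
      (mul_le_mul_of_nonneg_left (by linarith : 1 + |f| ≤ 2 + Cd) hδ0).trans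
        (by rw [mul_comm]; exact mul_le_mul_of_nonneg_left hδE (by linarith))
    have hE2 : c + σ * VC⁻¹ + δ * (1 + |f| + c + σ * VC⁻¹) + 2 * δ * VC⁻¹ ^ 2 ≤ 5e24 * (1 + Cd) ^ 2 * Err := by
      have h1' : δ * (1 + |f| + c + σ * VC⁻¹) = δ * (1 + |f|) + δ * c + δ * (σ * VC⁻¹) := by ring
      have h3' : ((4 + Cd + 2213 + 0.34) * Cδ + 4.5e5 + 1.36 + 1.02 * C3 + 8 * C4) * Err =
          (2 + Cd) * (Cδ * Err) + 2 * (Cδ * Err) + 2213 * (Cδ * Err) + 0.34 * (Cδ * Err) + 4.5e5 * Err +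
            1.36 * Err + 1.02 * (C3 * Err) + 8 * (C4 * Err) := by ring
      rw [h1']
      linarith
    rw [hV_eq]
    refine le_trans ?_ (halg.trans hΛ0)
    exact mul_le_mul_of_nonneg_left (by linarith) (mul_pos hVSpos hVCpos).le

omit hD hε hg hK1 h1 h01 in
/-- Monotonicity of `t + 12.5 K² t³` (auxiliary). [folklore] -/
theorem crude_aux {K t T : ℝ} (ht : 0 ≤ t) (htT : t ≤ T) :
    (1 + 12.5 * K ^ 2 * t ^ 2) * t ≤ T + 12.5 * K ^ 2 * T ^ 3 := by
  have h3 : t ^ 3 ≤ T ^ 3 := pow_le_pow_left₀ ht htT 3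
  have hK2 : 0 ≤ K ^ 2 := sq_nonneg K
  nlinarith [mul_le_mul_of_nonneg_left h3 hK2]

omit hD hε hg hK1 h1 h01 in
/-- **The crude regime, key inequality**: outside the main regime, `1 + 12.5 K² (log D)² ≤ 5·10²⁴ ε⁻⁸ eᴷ/log D`.
[folklore] -/
theorem crude_key {ε K t : ℝ} (hε : 0 < ε) (hε3 : ε ≤ 1 / 3) (hK1 : 1 ≤ K) (ht : 0 < t)
    (hcase : t < 200 * K * ε⁻¹ ^ 2 ∨ t < 4e4 * K ^ 2 ∨ t < 900 * ε⁻¹ ^ 2 ∨ (t ≤ ε⁻¹ ^ 4 ∧ 1 / 30 < ε)) :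
    1 + 12.5 * K ^ 2 * t ^ 2 ≤ 5e24 * (ε + ε⁻¹ ^ 8 * Real.exp K / t) := by
  have hK0 : 0 ≤ K := by linarith
  have hεi : 3 ≤ ε⁻¹ := by rw [le_inv_comm₀ (by norm_num) hε]; linarith
  have hεi1 : 1 ≤ ε⁻¹ := by linarith
  have he28 : ε⁻¹ ^ 2 ≤ ε⁻¹ ^ 8 := pow_le_pow_right₀ hεi1 (by norm_num)
  have he48 : ε⁻¹ ^ 4 ≤ ε⁻¹ ^ 8 := pow_le_pow_right₀ hεi1 (by norm_num)
  have he68 : ε⁻¹ ^ 6 ≤ ε⁻¹ ^ 8 := pow_le_pow_right₀ hεi1 (by norm_num)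
  have he08 : 1 ≤ ε⁻¹ ^ 8 := one_le_pow₀ hεi1
  obtain ⟨-, -, hK1e⟩ := pow_exp_bounds hK0
  have hK2 : K ^ 2 ≤ 2 * Real.exp K := by
    have := pow_le_factorial_mul_exp hK0 2
    rwa [show ((Nat.factorial 2 : ℕ) : ℝ) = 2 by norm_num [Nat.factorial]] at this
  have hK5 : K ^ 5 ≤ 120 * Real.exp K := by
    have := pow_le_factorial_mul_exp hK0 5
    rwa [show ((Nat.factorial 5 : ℕ) : ℝ) = 120 by norm_num [Nat.factorial]] at this
  have hK8 : K ^ 8 ≤ 40320 * Real.exp K := by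
    have := pow_le_factorial_mul_exp hK0 8
    rwa [show ((Nat.factorial 8 : ℕ) : ℝ) = 40320 by norm_num [Nat.factorial]] at this
  have heK : 1 ≤ Real.exp K := by linarith
  have heK0 : 0 < Real.exp K := Real.exp_pos K
  -- it suffices to bound `(1 + 12.5 K² t²) t ≤ 5e24 ε⁻⁸ eᴷ`
  suffices h : (1 + 12.5 * K ^ 2 * t ^ 2) * t ≤ 5e24 * (ε⁻¹ ^ 8 * Real.exp K) by
    have h' : 1 + 12.5 * K ^ 2 * t ^ 2 ≤ 5e24 * (ε⁻¹ ^ 8 * Real.exp K / t) := by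
      rw [mul_div_assoc', le_div_iff₀ ht]; exact h
    nlinarith [hε.le]
  set X := ε⁻¹ ^ 8 * Real.exp K with hX
  have hX0 : 0 ≤ X := by positivity
  rcases hcase with hc | hc | hc | ⟨hc, hε30⟩
  · refine (crude_aux ht.le hc.le).trans ?_
    have h1 : 200 * K * ε⁻¹ ^ 2 ≤ 200 * X := by
      rw [hX]; nlinarith [mul_le_mul hK1e he28 (by positivity) heK0.le]
    have h2 : 12.5 * K ^ 2 * (200 * K * ε⁻¹ ^ 2) ^ 3 = 1e8 * (K ^ 5 * ε⁻¹ ^ 6) := by ring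
    have h3 : K ^ 5 * ε⁻¹ ^ 6 ≤ 120 * X := by
      rw [hX]; nlinarith [mul_le_mul hK5 he68 (by positivity) (by positivity)]
    rw [h2]; nlinarith
  · refine (crude_aux ht.le hc.le).trans ?_
    have h1 : 4e4 * K ^ 2 ≤ 8e4 * X := by
      rw [hX]; nlinarith [mul_le_mul hK2 he08 (by positivity) (by positivity)]
    have h2 : 12.5 * K ^ 2 * (4e4 * K ^ 2) ^ 3 = 8e14 * K ^ 8 := by ring
    have h3 : K ^ 8 ≤ 40320 * X := by
      rw [hX]; nlinarith [mul_le_mul hK8 he08 (by positivity) (by positivity)]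
    rw [h2]; nlinarith
  · refine (crude_aux ht.le hc.le).trans ?_
    have h1 : 900 * ε⁻¹ ^ 2 ≤ 900 * X := by
      rw [hX]; nlinarith [mul_le_mul he28 heK (by positivity) (by positivity)]
    have h2 : 12.5 * K ^ 2 * (900 * ε⁻¹ ^ 2) ^ 3 = 9.1125e9 * (K ^ 2 * ε⁻¹ ^ 6) := by ring
    have h3 : K ^ 2 * ε⁻¹ ^ 6 ≤ 2 * X := by
      rw [hX]; nlinarith [mul_le_mul hK2 he68 (by positivity) (by positivity)]
    rw [h2]; nlinarith
  · refine (crude_aux ht.le hc).trans ?_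
    have hε4 : ε⁻¹ ^ 4 ≤ 810000 := by
      have : ε⁻¹ < 30 := by rw [inv_lt_comm₀ hε (by norm_num)]; rw [one_div] at hε30; exact hε30
      calc ε⁻¹ ^ 4 ≤ (30:ℝ) ^ 4 := pow_le_pow_left₀ (by linarith) this.le 4
        _ = 810000 := by norm_num
    have h1 : ε⁻¹ ^ 4 ≤ X := by
      rw [hX]; nlinarith [mul_le_mul he48 heK (by positivity) (by positivity)]
    have h2 : 12.5 * K ^ 2 * (ε⁻¹ ^ 4) ^ 3 = 12.5 * (K ^ 2 * ε⁻¹ ^ 4) * ε⁻¹ ^ 8 := by ring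
    have h3 : K ^ 2 * ε⁻¹ ^ 4 ≤ 2 * Real.exp K * 810000 := mul_le_mul hK2 hε4 (by positivity) (by positivity)
    have h4 : 12.5 * (K ^ 2 * ε⁻¹ ^ 4) * ε⁻¹ ^ 8 ≤ 12.5 * (2 * Real.exp K * 810000) * ε⁻¹ ^ 8 :=
      mul_le_mul_of_nonneg_right (mul_le_mul_of_nonneg_left h3 (by norm_num)) (by positivity)
    have h5 : 12.5 * (2 * Real.exp K * 810000) * ε⁻¹ ^ 8 = 2.025e7 * X := by rw [hX]; ring
    rw [h2]; nlinarith

omit hε hg h01 in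
/-- `V(z)⁻¹ ≤ 3.53 K log D` for `2 ≤ z ≤ D` under condition (1) (`K ≥ 1`). [folklore] -/
theorem inv_vprod_le_crude {z : ℝ} (hz : 2 ≤ z) (hzD : z ≤ D) :
    (BetaSieve.vprod g (primesProdBelow z))⁻¹ ≤ 3.53 * K * Real.log D := by
  have hK0 : 0 ≤ K := by linarith
  have ht0 : 0 < Real.log D := Real.log_pos hD
  have hl2 : 0.6931471803 < Real.log 2 := Real.log_two_gt_d9
  have hlogz : Real.log z ≤ Real.log D := Real.log_le_log (by linarith) hzD
  have hlogz0 : 0 ≤ Real.log z := Real.log_nonneg (by linarith)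
  rcases hz.eq_or_lt with rfl | hz2
  · -- `P(2) = 1`
    have : primesProdBelow (2:ℝ) = 1 := by
      rw [primesProdBelow, show ⌈(2:ℝ)⌉₊ = 2 by norm_num]; decide
    rw [this]; simp [BetaSieve.vprod]
    nlinarith [Real.log_pos (show (1:ℝ) < 2 by norm_num)]
  · have hP2 : primesProdBelow (2:ℝ) = 1 := by
      rw [primesProdBelow, show ⌈(2:ℝ)⌉₊ = 2 by norm_num]; decide
    have h := inv_vprod_Ico_le (g := g) (K := K) h1 le_rfl hz2
    have hPz : primesProdBelow z = primesProdIco 2 z := by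
      rw [← primesProdBelow_mul_primesProdIco hz, hP2, one_mul]
    rw [hPz]
    refine h.trans ?_
    have hK' : 1 + K / Real.log 2 ≤ 2.443 * K := by
      have : K / Real.log 2 ≤ 1.443 * K := by rw [div_le_iff₀ (by linarith)]; nlinarith
      linarith
    have hr : Real.log z / Real.log 2 ≤ 1.443 * Real.log D := by
      rw [div_le_iff₀ (by linarith)]; nlinarith
    calc Real.log z / Real.log 2 * (1 + K / Real.log 2) ≤ 1.443 * Real.log D * (2.443 * K) :=
          mul_le_mul hr hK' (by positivity) (by positivity)
      _ ≤ 3.53 * K * Real.log D := by nlinarith [mul_nonneg hK0 ht0.le]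

/-- **The crude regime**: outside the main regime the trivial bound `|∑ Λ_z g| ≤ V(z)⁻¹` already gives
both main-term inequalities with `E = 5·10²⁴ (ε + ε⁻⁸ eᴷ/log D)`. [folklore] -/
theorem crude_regime_bounds (hε3 : ε ≤ 1 / 3)
    (hcase : Real.log D < 200 * K * ε⁻¹ ^ 2 ∨ Real.log D < 4e4 * K ^ 2 ∨ Real.log D < 900 * ε⁻¹ ^ 2 ∨
      (Real.log D ≤ ε⁻¹ ^ 4 ∧ 1 / 30 < ε)) {z : ℝ} (hz : 2 ≤ z) (hzD : z ≤ D) :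
    (∑ d ∈ (primesProdBelow z).divisors, LamZ hD hε 1 z d * g d ≤
        BetaSieve.vprod g (primesProdBelow z) *
          (upperSieveFun 1 (Real.log D / Real.log z) + 5e24 * (ε + ε⁻¹ ^ 8 * Real.exp K / Real.log D))) ∧
    (z ^ 2 ≤ D →
      BetaSieve.vprod g (primesProdBelow z) *
          (lowerSieveFun 1 (Real.log D / Real.log z) - 5e24 * (ε + ε⁻¹ ^ 8 * Real.exp K / Real.log D)) ≤
        ∑ d ∈ (primesProdBelow z).divisors, LamZ hD hε 0 z d * g d) := by
  have hK0 : 0 ≤ K := by linarith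
  have ht0 : 0 < Real.log D := Real.log_pos hD
  set V := BetaSieve.vprod g (primesProdBelow z) with hV
  have hVpos : 0 < V := vprod_pos_of_lt_one fun p hp => (h01 p (Nat.prime_of_mem_primeFactors hp)).2
  have hVi := inv_vprod_le_crude hD hK1 h1 hz hzD
  have hkey := crude_key hε hε3 hK1 ht0 hcase
  set E := 5e24 * (ε + ε⁻¹ ^ 8 * Real.exp K / Real.log D) with hE
  have hVi2 : V⁻¹ ^ 2 ≤ 12.5 * K ^ 2 * Real.log D ^ 2 := by
    calc V⁻¹ ^ 2 ≤ (3.53 * K * Real.log D) ^ 2 := pow_le_pow_left₀ (inv_nonneg.mpr hVpos.le) hVi 2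
      _ ≤ _ := by nlinarith [sq_nonneg (K * Real.log D)]
  have hE1 : 1 + V⁻¹ ^ 2 ≤ E := by linarith
  have hlogz0 : 0 < Real.log z := Real.log_pos (by linarith)
  have hs1 : 1 ≤ Real.log D / Real.log z := by
    rw [le_div_iff₀ hlogz0, one_mul]; exact Real.log_le_log (by linarith) hzD
  have hF1 : 1 ≤ upperSieveFun 1 (Real.log D / Real.log z) := by
    have := BetaSieve.Iwaniec1980_lemma18_holds.one_le_upper (by norm_num : (1:ℝ) / 2 ≤ 1)
      JurkatRichert.isGreatestBetaSieveData_linear (s := Real.log D / Real.log z) (by linarith)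
    simpa using this
  have hVVi : V * V⁻¹ ^ 2 = V⁻¹ := by field_simp
  constructor
  · have h := (abs_le.mp (abs_mainSum_LamZ_le hD hε hg h01 1 z)).2
    calc _ ≤ V⁻¹ := h
      _ = V * V⁻¹ ^ 2 := hVVi.symm
      _ ≤ _ := mul_le_mul_of_nonneg_left (by linarith) hVpos.le
  · intro hz2D
    have hs2 : 2 ≤ Real.log D / Real.log z := by
      rw [le_div_iff₀ hlogz0]
      have : Real.log (z ^ 2) ≤ Real.log D := Real.log_le_log (by positivity) hz2D
      rw [Real.log_pow] at this; push_cast at this; linarith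
    have hf1 : lowerSieveFun 1 (Real.log D / Real.log z) ≤ 1 := by
      have := BetaSieve.Iwaniec1980_lemma18_holds.lower_le_one (by norm_num : (1:ℝ) / 2 ≤ 1)
        JurkatRichert.isGreatestBetaSieveData_linear (s := Real.log D / Real.log z)
          (by show siftingLimit 1 ≤ _; rw [siftingLimit_one_holds]; exact hs2)
      simpa using this
    have h := (abs_le.mp (abs_mainSum_LamZ_le hD hε hg h01 0 z)).1
    calc _ ≤ V * (-V⁻¹ ^ 2) := mul_le_mul_of_nonneg_left (by linarith) hVpos.le
      _ = -V⁻¹ := by rw [mul_neg, hVVi]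
      _ ≤ _ := h


end Regime

end Core

end Iwaniec1980b

end Literature.NumberTheory.Sieve

end
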